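import Literature.NumberTheory.EllipticCurves.CyclotomicZpExtensionLocalGeneratorProofs
import Literature.NumberTheory.EllipticCurves.SubgroupSelmer
import Literature.NumberTheory.GaloisRepresentations.ArtinRestriction
import Literature.NumberTheory.EllipticCurves.CyclotomicZpExtension
import Literature.NumberTheory.GaloisRepresentations.LocalKroneckerWeberInertiaProofs
import Mathlib.RingTheory.Norm.Transitivity
import Mathlib.RingTheory.Adjoin.PowerBasis
import Mathlib.Algebra.Polynomial.Degree.SmallDegree
import Mathlib.Algebra.Order.BigOperators.Group.Finset
import Mathlib.Data.Set.Card
import Mathlib.NumberTheory.Padics.Hensel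
import Mathlib.NumberTheory.Padics.RingHoms
import Mathlib.Data.ZMod.Units
import Mathlib.FieldTheory.Finite.Basic
import Literature.NumberTheory.GaloisRepresentations.LocalClassFieldAxiom
import Literature.NumberTheory.Automorphic.AdicCompletionLocalField
import Mathlib.FieldTheory.Galois.Infinite
import HarnessLib

/-!
# The local cyclotomic `ℤ_p`-tower at `v ∋ p`: layer subgroups, layer fields, and at `p = 2` the cyclotomic action, generators, `2`-adic units, norm groups and tower cosets (re-homed proofs, file 1 of 2)

Family `bsd` material RE-HOMED into `Literature/` by the Hodge foundations lane (`lit-hodgefound`, seat p20, generation 35),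
file 1 of 2: verbatim ports, in dependency order and each with its original module docstring (Parts 1–7), of the cell `bsd-2adic`
TOWER-road modules `Summits/BirchSwinnertonDyer/BirchSwinnertonDyer/Theorems/ByReductionTypeAtTwoMultTowerNS2{LocalLayerIndex,
LocalLayerField, LocalCyclotomicAction, LocalLayerGenerator, TwoAdicUnits, LayerNormGroup, TowerCosets}.lean` (route
`ByReductionTypeAtTwo`, crux `MultUpperHalfAtTwo`, item stmt-BirchSwinnertonDyer-19922), namespace
`Summit.BirchSwinnertonDyer.BirchSwinnertonDyer.Theorems.MultTowerNS2` re-rooted as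
`Literature.NumberTheory.EllipticCurves.Greenberg1999.MultTowerNS2`; theorems only (no definition, no named fact), imports
Literature/Mathlib only; all `[folklore]` helpers privatised; `open` commands made `_root_`-explicit (inside the `Literature.…`
namespace a bare `open Polynomial` / `open WeierstrassCurve` would resolve to a `Literature.…` sub-namespace).  CONTENT (the
local cyclotomic `ℤ_p`-tower `ℚ_v ⊂ F_{v,1} ⊂ ⋯` at a prime `v ∋ p` of `ℚ`, Greenberg LNM 1716 §3 set-up, Washington Ch. 2,
Neukirch ANT II/V, Serre *Local Fields*): the local layer subgroups `H_n = res⁻¹(Γ_n)`, their indices and fixed fields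
(Parts 1–2); at `p = 2`: the cyclotomic action and the layer fields `ℚ_2(ζ_{2^{m+2}} + ζ_{2^{m+2}}⁻¹)` with the layer
polynomials `P_m` (Part 3), topological generators of `H_n / H_{n+1}` (Part 4), `2`-adic units and squares (Part 5), the layer
NORM GROUPS (Part 6) and the tower cosets `H_n = ⨆ g^i H_{n+R}` with the layer-wise `smul` bookkeeping (Part 7).  WHY: this is
the lower half of the import cone of the sibling file `SplitMultiplicativeLocalTowerKernelPTorsionProofs` (file 2 of 2), which
carries the only proof in the tree of the Literature named fact
`NumberTheory.EllipticCurves.Greenberg1999.sec3_natCard_pTorsion_localTowerKerPrimary_le_splitMultiplicative_rat`; `Literature/`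
could not import the Summits originals.  The Summits originals stay in place (transitional duplication; cited here).  Honest
framing of the originals stands: nothing is booked, BSD is not proved by any of this.
-/

noncomputable section

/-!
## Part 1 — port of `Summits/BirchSwinnertonDyer/BirchSwinnertonDyer/Theorems/ByReductionTypeAtTwoMultTowerNS2LocalLayerIndex.lean`

# Route `ByReductionTypeAtTwo`, crux `MultUpperHalfAtTwo` (item stmt-BirchSwinnertonDyer-19922), TOWER road, the
# «ONE BIT AT A NON-SPLIT 2» rows: KERNEL BRICK 8 — the LOCAL layers of the cyclotomic `ℤ_p`-tower at `v ∣ p` have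
# index exactly `p^n` in `Γ_{ℚ_v}` (total ramification), consecutive relative index `p`

HONEST FRAMING (cell `bsd-2adic`, run/shared/lean/pub/bsd-2adic/, seat `bsd-2adic-tower-1` GEN 8, HUMAN RULINGS
D-0036 / D-0054 / D-0074): TOOL theorems only (no definition, no named fact, no `sorry`); closes nothing by itself;
nothing booked; BSD is not proved by any of this. First brick of module M5 («the local tower at 2») of the KERNELISATION
of the displayed MEMO binder `MultTowerNS2.localTowerKerTwoTorsion_le_two_nonsplitTwo_of_tateUnit` (scope
HOME/tower/SCOPE-hNS2one-kernel-GEN8.md): the local layer subgroups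
`H_n = localSubgroup (κ.layerSubgroup n) ℚ_v = res_v⁻¹(κ⁻¹(pⁿ ℤ_p)) ≤ Γ_{ℚ_v}` (the groups in which the local tower kernels
`WeierstrassCurve.localTowerKer κ ℚ_v n` live) have index `p^n` — i.e. `[(ℚ_n)_w : ℚ_v] = p^n = [ℚ_n : ℚ]`, `p` is TOTALLY
RAMIFIED in the cyclotomic `ℤ_p`-extension — and `[H_n : H_{n+1}] = p` (for `p = 2`: the local layers
`ℚ_{2,n} = ℚ₂(ζ_{2^{n+2}} + ζ⁻¹)` are successive QUADRATIC extensions, the shape used in the scope's steps S5/S6).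
Input: the tree theorem `ZpExtension.IsCyclotomic.exists_apply_resGalOfEmb_adicCompletion_eq` («`κ ∘ res_v` is onto»,
`CyclotomicZpExtensionLocalGeneratorProofs.lean`) and `ZpExtension.index_toSubgroup_span_pow`.

* `surjective_kappa_comp_resGal` — `κ ∘ resGal ℚ_v : Γ_{ℚ_v} → ℤ_p` is surjective (`v ∣ p`, `κ` cyclotomic);
* `index_localSubgroup_layerSubgroup` — `[Γ_{ℚ_v} : H_n] = p^n`;
* `relIndex_localSubgroup_layerSubgroup_succ` — `[H_n : H_{n+1}] = p`;
* `exists_mem_absInertia_mem_localSubgroup_kerSubgroup` — every `σ ∈ Γ_{ℚ_v}` is `τ · h` with `τ` in the local INERTIA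
  group and `h ∈ H_∞ = localSubgroup κ.kerSubgroup ℚ_v` (`Γ_{ℚ_v} = I · H_∞`; used in M6/S1–S2 to pick INERTIAL
  topological generators of `H_n/H_∞` and an element of `H_∞` flipping `√γ`).

References: L. Washington, *Introduction to Cyclotomic Fields*, §13.1, Prop. 13.2; R. Greenberg, LNM 1716 §1, §3 p. 86;
scope memo SCOPE-hNS2one-kernel-GEN8.md M5.
-/

section Part1

set_option autoImplicit false

namespace Literature.NumberTheory.EllipticCurves.Greenberg1999.MultTowerNS2

open _root_.NumberField _root_.IsDedekindDomain _root_.Field _root_.Literature.NumberTheory.EllipticCurves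
  _root_.Literature.NumberTheory.GaloisRepresentations

variable {p : ℕ} [Fact p.Prime] {κ : ZpExtension ℚ p}

/-- **`κ ∘ res_v : Γ_{ℚ_v} → ℤ_p` is surjective** for the cyclotomic `ℤ_p`-extension and `v ∣ p` (`resGal ℚ_v` is the
tree's chosen restriction `resGalOfEmb (closureEmb ℚ_v)`). [cite: Washington1997, §13.1] -/
theorem surjective_kappa_comp_resGal (hκ : κ.IsCyclotomic) (v : HeightOneSpectrum (𝓞 ℚ))
    (hv : (p : 𝓞 ℚ) ∈ v.asIdeal) :
    Function.Surjective (κ.toContinuousMonoidHom.toMonoidHom.comp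
      (resGal (K := ℚ) (v.adicCompletion ℚ)).toMonoidHom) := by
  intro t
  obtain ⟨g, hg⟩ := hκ.exists_apply_resGalOfEmb_adicCompletion_eq v hv t
  exact ⟨g, hg⟩

/-- The local layer subgroup is the preimage of `pⁿ ℤ_p` under `κ ∘ res_v`. [folklore] -/
private theorem localSubgroup_layerSubgroup_eq_comap (v : HeightOneSpectrum (𝓞 ℚ)) (n : ℕ) :
    localSubgroup (κ.layerSubgroup n) (v.adicCompletion ℚ) =
      (AddSubgroup.toSubgroup (Ideal.span {(p : ℤ_[p]) ^ n}).toAddSubgroup).comap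
        (κ.toContinuousMonoidHom.toMonoidHom.comp (resGal (K := ℚ) (v.adicCompletion ℚ)).toMonoidHom) := by
  ext τ
  rw [mem_localSubgroup_iff, Subgroup.mem_comap]
  rfl

/-- **`[Γ_{ℚ_v} : H_n] = p^n`**: the local layer subgroup `H_n = res_v⁻¹(κ⁻¹(pⁿℤ_p))` of the cyclotomic `ℤ_p`-tower
at `v ∣ p` has index `p^n` — the local degree `[(ℚ_n)_w : ℚ_v]` equals the global degree `[ℚ_n : ℚ] = p^n` (`p`
totally ramified in `ℚ_∞/ℚ`). [cite: Washington1997, §13.1] -/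
theorem index_localSubgroup_layerSubgroup (hκ : κ.IsCyclotomic) (v : HeightOneSpectrum (𝓞 ℚ))
    (hv : (p : 𝓞 ℚ) ∈ v.asIdeal) (n : ℕ) :
    (localSubgroup (κ.layerSubgroup n) (v.adicCompletion ℚ)).index = p ^ n := by
  rw [localSubgroup_layerSubgroup_eq_comap v n,
    Subgroup.index_comap_of_surjective _ (surjective_kappa_comp_resGal hκ v hv),
    ZpExtension.index_toSubgroup_span_pow]

/-- `H_{n+1} ≤ H_n` for the local layer subgroups. [folklore] -/
private theorem localSubgroup_layerSubgroup_succ_le (v : HeightOneSpectrum (𝓞 ℚ)) (n : ℕ) :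
    localSubgroup (κ.layerSubgroup (n + 1)) (v.adicCompletion ℚ) ≤
      localSubgroup (κ.layerSubgroup n) (v.adicCompletion ℚ) :=
  Subgroup.comap_mono (κ.layerSubgroup_antitone (Nat.le_succ n))

/-- **`[H_n : H_{n+1}] = p`**: consecutive local layers of the cyclotomic `ℤ_p`-tower at `v ∣ p` have relative index `p`
(for `p = 2`: the local layers are successive quadratic extensions). [cite: Washington1997, §13.1] -/
theorem relIndex_localSubgroup_layerSubgroup_succ (hκ : κ.IsCyclotomic) (v : HeightOneSpectrum (𝓞 ℚ))
    (hv : (p : 𝓞 ℚ) ∈ v.asIdeal) (n : ℕ) :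
    (localSubgroup (κ.layerSubgroup (n + 1)) (v.adicCompletion ℚ)).relIndex
      (localSubgroup (κ.layerSubgroup n) (v.adicCompletion ℚ)) = p := by
  have h := Subgroup.relIndex_mul_index (localSubgroup_layerSubgroup_succ_le (κ := κ) v n)
  rw [index_localSubgroup_layerSubgroup hκ v hv, index_localSubgroup_layerSubgroup hκ v hv, pow_succ,
    mul_comm] at h
  exact mul_right_cancel₀ (pow_ne_zero n (Fact.out : p.Prime).ne_zero) (by linarith [h])

/-- **`Γ_{ℚ_v} = I · H_∞`-type decomposition, layer form**: for every `σ ∈ Γ_{ℚ_v}` there is `τ` in the INERTIA group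
`absInertia ℚ_v` with `κ(res τ) = κ(res σ)`, hence `τ⁻¹ σ ∈ H_∞ = localSubgroup κ.kerSubgroup ℚ_v` — every local layer
subgroup is generated by `H_∞` and inertial elements. [cite: Washington1997, §13.1] -/
theorem exists_mem_absInertia_mem_localSubgroup_kerSubgroup (hκ : κ.IsCyclotomic) (v : HeightOneSpectrum (𝓞 ℚ))
    (hv : (p : 𝓞 ℚ) ∈ v.asIdeal) (σ : absoluteGaloisGroup (v.adicCompletion ℚ)) :
    ∃ τ : absoluteGaloisGroup (v.adicCompletion ℚ), τ ∈ absInertia (v.adicCompletion ℚ) ∧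
      τ⁻¹ * σ ∈ localSubgroup κ.kerSubgroup (v.adicCompletion ℚ) := by
  obtain ⟨τ, hτI, hτ⟩ := hκ.exists_mem_absInertia_apply_resGalOfEmb_adicCompletion_eq v hv
    (κ (resGal (K := ℚ) (v.adicCompletion ℚ) σ))
  refine ⟨τ, hτI, ?_⟩
  rw [mem_localSubgroup_iff, ZpExtension.mem_kerSubgroup, map_mul, map_inv, map_mul, map_inv]
  change (κ (resGalOfEmb (closureEmb (K := ℚ) (v.adicCompletion ℚ)) τ))⁻¹ * _ = 1
  rw [hτ, inv_mul_cancel]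

end Literature.NumberTheory.EllipticCurves.Greenberg1999.MultTowerNS2

end Part1

/-!
## Part 2 — port of `Summits/BirchSwinnertonDyer/BirchSwinnertonDyer/Theorems/ByReductionTypeAtTwoMultTowerNS2LocalLayerField.lean`

# Route `ByReductionTypeAtTwo`, crux `MultUpperHalfAtTwo` (item stmt-BirchSwinnertonDyer-19922), TOWER road, the
# «ONE BIT AT A NON-SPLIT 2» rows: KERNEL BRICK 9 — the local layer FIELDS `(ℚ_n)_w = K̄_v^{H_n}` of the cyclotomic
# `ℤ_p`-tower at `v ∣ p` are finite of degree `p^n` over `ℚ_v`, nested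

HONEST FRAMING (cell `bsd-2adic`, run/shared/lean/pub/bsd-2adic/, seat `bsd-2adic-tower-1` GEN 8, HUMAN RULINGS
D-0036 / D-0054 / D-0074): TOOL theorems only (no definition, no named fact, no `sorry`); closes nothing by itself;
nothing booked; BSD is not proved by any of this. Second brick of module M5 («the local tower at 2») of the KERNELISATION of
the displayed MEMO binder `MultTowerNS2.localTowerKerTwoTorsion_le_two_nonsplitTwo_of_tateUnit` (scope
HOME/tower/SCOPE-hNS2one-kernel-GEN8.md): the fixed fields `F_n := K̄_v^{H_n}`,
`H_n = localSubgroup (κ.layerSubgroup n) ℚ_v` (BRICK 8: index `p^n`, open), as `IntermediateField ℚ_v K̄_v` — the local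
layers `ℚ_{p,n}` (for `p = 2`: `ℚ₂(ζ_{2^{n+2}} + ζ⁻¹)`) on which steps S4–S6 of the scope run the class field axiom
(`cyclicNormIndexEq_holds` is stated for such intermediate fields). Krull correspondence for open subgroups:
tree `GaloisRepresentations.finrank_fixedField_of_isOpen` / `finiteDimensional_fixedField_of_isOpen` (`ArtinRestriction.lean`).

* `isOpen_localSubgroup` — `localSubgroup H E` is open for `H` open (preimage under the continuous restriction);
* `finiteDimensional_fixedField_localSubgroup_layerSubgroup`, **`finrank_fixedField_localSubgroup_layerSubgroup`**
  (`= p^n`), `finrank_fixedField_localSubgroup_layerSubgroup_succ` (`[F_{n+1} : ℚ_v] = p · [F_n : ℚ_v]`),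
  `fixedField_localSubgroup_layerSubgroup_le_succ` (`F_n ≤ F_{n+1}`).

References: L. Washington, *Introduction to Cyclotomic Fields*, §13.1; J. Neukirch, *ANT* IV §1 (Krull); scope memo M5.
-/

section Part2

set_option autoImplicit false

namespace Literature.NumberTheory.EllipticCurves.Greenberg1999.MultTowerNS2

open _root_.NumberField _root_.IsDedekindDomain _root_.Field _root_.Literature.NumberTheory.EllipticCurves
  _root_.Literature.NumberTheory.GaloisRepresentations

universe u

/-- `localSubgroup H E = res⁻¹(H)` is open in `Γ_E` when `H` is open in `Γ_K` (the restriction `resGal E` is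
continuous). [folklore] -/
private theorem isOpen_localSubgroup {K : Type u} [Field K] (H : Subgroup (absoluteGaloisGroup K))
    (hH : IsOpen (H : Set (absoluteGaloisGroup K))) (E : Type u) [Field E] [Algebra K E] :
    IsOpen (localSubgroup H E : Set (absoluteGaloisGroup E)) :=
  hH.preimage (resGal (K := K) E).continuous_toFun

variable {p : ℕ} [Fact p.Prime] {κ : ZpExtension ℚ p}

/-- The local layer field `F_n = K̄_v^{H_n}` is a finite extension of `ℚ_v`. [cite: Washington1997, §13.1] -/
theorem finiteDimensional_fixedField_localSubgroup_layerSubgroup (v : HeightOneSpectrum (𝓞 ℚ)) (n : ℕ) :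
    FiniteDimensional (v.adicCompletion ℚ)
      (IntermediateField.fixedField (localSubgroup (κ.layerSubgroup n) (v.adicCompletion ℚ)) :
        IntermediateField (v.adicCompletion ℚ) (AlgebraicClosure (v.adicCompletion ℚ))) := by
  have hopen := isOpen_localSubgroup (κ.layerSubgroup n) (κ.isOpen_layerSubgroup n) (v.adicCompletion ℚ)
  haveI : CharZero (v.adicCompletion ℚ) :=
    charZero_of_injective_algebraMap (algebraMap ℚ (v.adicCompletion ℚ)).injective
  exact finiteDimensional_fixedField_of_isOpen _ hopen

/-- **`[F_n : ℚ_v] = p^n`**: the fixed field of the `n`-th local layer subgroup of the cyclotomic `ℤ_p`-tower at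
`v ∣ p` has degree `p^n` over `ℚ_v` — the local degree equals the global one, `p` is totally ramified
(BRICK 8 `index_localSubgroup_layerSubgroup` + Krull). [cite: Washington1997, §13.1] -/
theorem finrank_fixedField_localSubgroup_layerSubgroup (hκ : κ.IsCyclotomic) (v : HeightOneSpectrum (𝓞 ℚ))
    (hv : (p : 𝓞 ℚ) ∈ v.asIdeal) (n : ℕ) :
    Module.finrank (v.adicCompletion ℚ)
      (IntermediateField.fixedField (localSubgroup (κ.layerSubgroup n) (v.adicCompletion ℚ)) :
        IntermediateField (v.adicCompletion ℚ) (AlgebraicClosure (v.adicCompletion ℚ))) = p ^ n := by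
  have hopen := isOpen_localSubgroup (κ.layerSubgroup n) (κ.isOpen_layerSubgroup n) (v.adicCompletion ℚ)
  have hidx := index_localSubgroup_layerSubgroup hκ v hv n
  haveI : CharZero (v.adicCompletion ℚ) :=
    charZero_of_injective_algebraMap (algebraMap ℚ (v.adicCompletion ℚ)).injective
  have h := finrank_fixedField_of_isOpen _ hopen
  rw [hidx] at h
  exact h

/-- **`[F_{n+1} : ℚ_v] = p · [F_n : ℚ_v]`** (so `[F_{n+1} : F_n] = p`; for `p = 2` the local layers are successive
QUADRATIC extensions). [cite: Washington1997, §13.1] -/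
theorem finrank_fixedField_localSubgroup_layerSubgroup_succ (hκ : κ.IsCyclotomic) (v : HeightOneSpectrum (𝓞 ℚ))
    (hv : (p : 𝓞 ℚ) ∈ v.asIdeal) (n : ℕ) :
    Module.finrank (v.adicCompletion ℚ)
      (IntermediateField.fixedField (localSubgroup (κ.layerSubgroup (n + 1)) (v.adicCompletion ℚ)) :
        IntermediateField (v.adicCompletion ℚ) (AlgebraicClosure (v.adicCompletion ℚ))) =
      p * Module.finrank (v.adicCompletion ℚ)
        (IntermediateField.fixedField (localSubgroup (κ.layerSubgroup n) (v.adicCompletion ℚ)) :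
          IntermediateField (v.adicCompletion ℚ) (AlgebraicClosure (v.adicCompletion ℚ))) := by
  rw [finrank_fixedField_localSubgroup_layerSubgroup hκ v hv, finrank_fixedField_localSubgroup_layerSubgroup hκ v hv,
    pow_succ, mul_comm]

/-- **`F_n ≤ F_{n+1}`**: the local layer fields increase (`H_{n+1} ≤ H_n`). [cite: Washington1997, §13.1] -/
theorem fixedField_localSubgroup_layerSubgroup_le_succ (v : HeightOneSpectrum (𝓞 ℚ)) (n : ℕ) :
    (IntermediateField.fixedField (localSubgroup (κ.layerSubgroup n) (v.adicCompletion ℚ)) :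
        IntermediateField (v.adicCompletion ℚ) (AlgebraicClosure (v.adicCompletion ℚ))) ≤
      IntermediateField.fixedField (localSubgroup (κ.layerSubgroup (n + 1)) (v.adicCompletion ℚ)) :=
  IntermediateField.fixedField_le (localSubgroup_layerSubgroup_succ_le (κ := κ) v n)

end Literature.NumberTheory.EllipticCurves.Greenberg1999.MultTowerNS2

end Part2

/-!
## Part 3 — port of `Summits/BirchSwinnertonDyer/BirchSwinnertonDyer/Theorems/ByReductionTypeAtTwoMultTowerNS2LocalCyclotomicAction.lean`

# Route `ByReductionTypeAtTwo`, crux `MultUpperHalfAtTwo` (item stmt-BirchSwinnertonDyer-19922), TOWER road, the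
# «ONE BIT AT A NON-SPLIT 2» rows: KERNEL BRICK 13a — the local layer subgroups `H_m ≤ Γ_{ℚ_v}` of the cyclotomic
# `ℤ₂`-tower through the `2`-adic cyclotomic character: `H_m` acts on `μ_{2^{m+2}}` by `ζ ↦ ζ^{±1}`

HONEST FRAMING (cell `bsd-2adic`, run/shared/lean/pub/bsd-2adic/, seat `bsd-2adic-tower-1` GEN 9, HUMAN RULINGS
D-0036 / D-0054 / D-0074): TOOL theorems only (no definition, no named fact, no `sorry`); closes nothing by itself;
nothing booked; BSD is not proved by any of this. Module M5 of the KERNELISATION of the displayed MEMO binder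
`MultTowerNS2.localTowerKerTwoTorsion_le_two_nonsplitTwo_of_tateUnit` (scope memo HOME/tower/SCOPE-hNS2one-kernel-GEN8.md):
the local layer subgroup `H_m = localSubgroup (κ.layerSubgroup m) ℚ_v` (`v ∋ 2`, `κ` the cyclotomic `ℤ₂`-extension,
`ker κ = χ₂⁻¹(μ(ℤ₂)) = χ₂⁻¹(±1)`) is read through the LOCAL `2`-adic cyclotomic character
`χ = GaloisRep.cyclotomicCharacter ℚ_v 2` (`χ_ℚ ∘ res_v = χ`, tree `cyclotomicCharacter_absGaloisRestrict`):

* `eq_one_or_eq_neg_one_of_isOfFinOrder` — `μ(ℤ₂) = {±1}` (from the tree's normalised logarithm `CyclotomicZp.ell`);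
* `exists_cyclotomicCharacter_eq_of_mem_localSubgroup_layerSubgroup` — for `σ ∈ H_m`: `χ(σ) = ± w^{2^m}`, `w ∈ ℤ₂ˣ`;
* `toZModPow_cyclotomicCharacter_of_mem_localSubgroup_layerSubgroup` — hence `χ(σ) ≡ ±1 (mod 2^{m+2})`;
* `smul_eq_or_eq_inv_of_mem_localSubgroup_layerSubgroup` — so `σ ζ ∈ {ζ, ζ⁻¹}` for every `2^{m+2}`-th root of
  unity `ζ ∈ K̄_v`, and `ζ + ζ⁻¹` lies in the local layer field `F_m = K̄_v^{H_m}`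
  (`add_inv_mem_fixedField_localSubgroup_layerSubgroup`);
* `exists_toZModPow_cyclotomicCharacter_eq` — local surjectivity `χ(Γ_{ℚ_v}) ↠ (ℤ/2^k)ˣ` (tree
  `adicCompletion_rat_exists_mem_absInertia_cyclotomicCharacter_eq`), and `exists_smul_eq_pow`: every `ζ^c`, `c` odd,
  is a Galois conjugate of `ζ`.

References: L. Washington, *Introduction to Cyclotomic Fields*, §13.1; J.-P. Serre, *Local Fields* IV §4 Prop. 17;
scope memo M5.
-/

section Part3

set_option autoImplicit false

open scoped _root_.Classical

namespace Literature.NumberTheory.EllipticCurves.Greenberg1999.MultTowerNS2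

open _root_.NumberField _root_.IsDedekindDomain _root_.Field _root_.PadicInt _root_.Literature.NumberTheory.EllipticCurves
  _root_.Literature.NumberTheory.GaloisRepresentations

/-! ### `μ(ℤ₂) = {±1}` and `(ℤ₂ˣ)^{2^m} ≡ ±1 (mod 2^{m+2})` -/

/-- **The roots of unity of `ℤ₂` are `±1`**: a unit of finite order is `1` or `−1` (the normalised logarithm
`ℓ` of the tree kills it, so `u² = u^{φ(4)} = γ_cyc^{2·ℓ(u)} = 1`). [folklore] -/
private theorem eq_one_or_eq_neg_one_of_isOfFinOrder {u : ℤ_[2]ˣ} (hu : IsOfFinOrder u) : u = 1 ∨ u = -1 := by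
  have hell : CyclotomicZp.ell 2 u = 0 := (CyclotomicZp.ell_eq_zero_iff 2 u).mpr hu
  have htor : Literature.NumberTheory.EllipticCurves.torsionOrder 2 = 2 := by
    simp only [Literature.NumberTheory.EllipticCurves.torsionOrder,
      Literature.NumberTheory.EllipticCurves.cyclotomicExponent, if_true]
    decide
  have h := CyclotomicZp.cycPow_torsionOrder_mul_ell 2 u
  rw [hell, mul_zero, AddChar.map_zero_eq_one, htor] at h
  have h2 : ((u : ℤ_[2]) - 1) * ((u : ℤ_[2]) + 1) = 0 := by linear_combination -h
  rcases mul_eq_zero.mp h2 with h1 | h1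
  · left; exact Units.ext (sub_eq_zero.mp h1)
  · right; exact Units.ext (eq_neg_of_add_eq_zero_left h1)

/-- Squaring raises the level: `x ≡ ±1 (mod 2^{k+2})` implies `x² ≡ 1 (mod 2^{k+3})`. [folklore] -/
private theorem toZModPow_succ_sq_eq_one {k : ℕ} {x : ℤ_[2]}
    (hx : toZModPow (k + 2) x = 1 ∨ toZModPow (k + 2) x = -1) : toZModPow (k + 3) (x ^ 2) = 1 := by
  obtain ⟨s, hs, hxs⟩ : ∃ s : ℤ_[2], s ^ 2 = 1 ∧ toZModPow (k + 2) x = toZModPow (k + 2) s := by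
    rcases hx with h | h
    · exact ⟨1, one_pow 2, by rw [h, map_one]⟩
    · exact ⟨-1, neg_one_sq, by rw [h, map_neg, map_one]⟩
  have hker : x - s ∈ RingHom.ker (toZModPow (p := 2) (k + 2)) := by
    rw [RingHom.mem_ker, map_sub, hxs, sub_self]
  rw [ker_toZModPow, Ideal.mem_span_singleton] at hker
  obtain ⟨t, ht⟩ := hker
  have hx2 : x ^ 2 - 1 = (2 : ℤ_[2]) ^ (k + 3) * (s * t + 2 ^ (k + 1) * t ^ 2) := by
    have hxe : x = s + 2 ^ (k + 2) * t := by linear_combination ht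
    rw [hxe]; ring_nf; rw [hs]; ring
  have hker2 : x ^ 2 - 1 ∈ RingHom.ker (toZModPow (p := 2) (k + 3)) := by
    rw [ker_toZModPow, Ideal.mem_span_singleton, hx2]
    exact dvd_mul_right _ _
  rwa [RingHom.mem_ker, map_sub, map_one, sub_eq_zero] at hker2

/-- **`w^{2^m} ≡ ±1 (mod 2^{m+2})`** for every `2`-adic unit `w` (`≡ ±1 (mod 4)` for `m = 0`, then square).
[folklore] -/
private theorem toZModPow_units_pow_two_pow (w : ℤ_[2]ˣ) (m : ℕ) :
    toZModPow (m + 2) ((w : ℤ_[2]) ^ 2 ^ m) = 1 ∨ toZModPow (m + 2) ((w : ℤ_[2]) ^ 2 ^ m) = -1 := by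
  induction m with
  | zero =>
    have hdec : ∀ a b : ZMod (2 ^ 2), a * b = 1 → a = 1 ∨ a = -1 := by decide
    have h := hdec (toZModPow 2 (w : ℤ_[2])) (toZModPow 2 ((w⁻¹ : ℤ_[2]ˣ) : ℤ_[2]))
      (by rw [← map_mul, Units.mul_inv, map_one])
    simpa using h
  | succ m ih =>
    left
    rw [pow_succ 2 m, pow_mul (w : ℤ_[2]) (2 ^ m) 2]
    exact toZModPow_succ_sq_eq_one ih

variable {κ : ZpExtension ℚ 2}

/-! ### `H_m` through the local cyclotomic character -/

/-- **`χ(σ) = ± w^{2^m}` for `σ ∈ H_m`.** For the cyclotomic `ℤ₂`-extension `κ` (`ker κ = χ₂⁻¹(μ(ℤ₂))`), the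
place `v ∋ 2` and `σ` in the local layer subgroup `H_m = res_v⁻¹(κ⁻¹(2^m ℤ₂))`: writing `κ(res σ) = 2^m · κ(τ)`,
the element `res σ · τ^{-2^m}` lies in `ker κ`, so its cyclotomic character is a root of unity of `ℤ₂`, i.e. `±1`;
and `χ_ℚ(res σ) = χ(σ)`. [cite: Washington1997, §13.1] -/
theorem exists_cyclotomicCharacter_eq_of_mem_localSubgroup_layerSubgroup (hκ : κ.IsCyclotomic)
    (v : HeightOneSpectrum (𝓞 ℚ)) {m : ℕ} {σ : absoluteGaloisGroup (v.adicCompletion ℚ)}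
    (hσ : σ ∈ localSubgroup (κ.layerSubgroup m) (v.adicCompletion ℚ)) :
    ∃ w : ℤ_[2]ˣ, GaloisRep.cyclotomicCharacter (v.adicCompletion ℚ) 2 σ = w ^ 2 ^ m ∨
      GaloisRep.cyclotomicCharacter (v.adicCompletion ℚ) 2 σ = -w ^ 2 ^ m := by
  rw [mem_localSubgroup_iff, ZpExtension.mem_layerSubgroup] at hσ
  obtain ⟨b, hb⟩ := hσ
  set ρ := resGal (K := ℚ) (v.adicCompletion ℚ) σ with hρ
  obtain ⟨τ, hτ⟩ := κ.surjective (Multiplicative.ofAdd b)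
  have hτ' : κ τ = Multiplicative.ofAdd b := hτ
  -- `ρ · (τ ^ 2^m)⁻¹ ∈ ker κ`
  have hker : ρ * (τ ^ 2 ^ m)⁻¹ ∈ κ.kerSubgroup := by
    rw [ZpExtension.mem_kerSubgroup, map_mul, map_inv, map_pow, hτ']
    apply Multiplicative.toAdd.injective
    rw [toAdd_mul, toAdd_inv, toAdd_pow, toAdd_ofAdd, hb, toAdd_one, nsmul_eq_mul]
    push_cast
    ring
  -- hence `χ_ℚ(ρ τ^{-2^m})` has finite order, i.e. is `±1`
  unfold ZpExtension.IsCyclotomic at hκ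
  rw [hκ, Subgroup.mem_comap, CommGroup.mem_torsion] at hker
  have hpm := eq_one_or_eq_neg_one_of_isOfFinOrder hker
  have hres : GaloisRep.cyclotomicCharacter ℚ 2 ρ = GaloisRep.cyclotomicCharacter (v.adicCompletion ℚ) 2 σ :=
    cyclotomicCharacter_absGaloisRestrict ℚ (v.adicCompletion ℚ) 2 σ
  refine ⟨GaloisRep.cyclotomicCharacter ℚ 2 τ, ?_⟩
  change (GaloisRep.cyclotomicCharacter ℚ 2).toMonoidHom (ρ * (τ ^ 2 ^ m)⁻¹) = 1 ∨
    (GaloisRep.cyclotomicCharacter ℚ 2).toMonoidHom (ρ * (τ ^ 2 ^ m)⁻¹) = -1 at hpm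
  rw [map_mul, map_inv, map_pow, mul_inv_eq_iff_eq_mul, mul_inv_eq_iff_eq_mul, one_mul] at hpm
  change GaloisRep.cyclotomicCharacter ℚ 2 ρ = GaloisRep.cyclotomicCharacter ℚ 2 τ ^ 2 ^ m ∨
    GaloisRep.cyclotomicCharacter ℚ 2 ρ = -1 * GaloisRep.cyclotomicCharacter ℚ 2 τ ^ 2 ^ m at hpm
  rw [hres, neg_one_mul] at hpm
  exact hpm

/-- **`χ(σ) ≡ ±1 (mod 2^{m+2})` for `σ ∈ H_m`** (`χ(σ) = ±w^{2^m}` and `w^{2^m} ≡ ±1`). [cite: Washington1997, §13.1] -/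
theorem toZModPow_cyclotomicCharacter_of_mem_localSubgroup_layerSubgroup (hκ : κ.IsCyclotomic)
    (v : HeightOneSpectrum (𝓞 ℚ)) {m : ℕ} {σ : absoluteGaloisGroup (v.adicCompletion ℚ)}
    (hσ : σ ∈ localSubgroup (κ.layerSubgroup m) (v.adicCompletion ℚ)) :
    toZModPow (m + 2) ((GaloisRep.cyclotomicCharacter (v.adicCompletion ℚ) 2 σ : ℤ_[2]ˣ) : ℤ_[2]) = 1 ∨
      toZModPow (m + 2) ((GaloisRep.cyclotomicCharacter (v.adicCompletion ℚ) 2 σ : ℤ_[2]ˣ) : ℤ_[2]) = -1 := by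
  obtain ⟨w, hw⟩ := exists_cyclotomicCharacter_eq_of_mem_localSubgroup_layerSubgroup hκ v hσ
  have hw2 := toZModPow_units_pow_two_pow w m
  rcases hw with h | h <;> rw [h]
  · simpa [Units.val_pow_eq_pow_val] using hw2
  · rw [Units.val_neg, map_neg, Units.val_pow_eq_pow_val]
    rcases hw2 with h2 | h2 <;> rw [h2]
    · right; rfl
    · left; rw [neg_neg]

/-- **`H_m` acts on `μ_{2^{m+2}}(K̄_v)` by `ζ ↦ ζ^{±1}`**: for `σ ∈ H_m` and `ζ ∈ K̄_v` with `ζ^{2^{m+2}} = 1`,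
`σ ζ = ζ` or `σ ζ = ζ⁻¹`. [cite: Washington1997, §13.1] -/
theorem smul_eq_or_eq_inv_of_mem_localSubgroup_layerSubgroup (hκ : κ.IsCyclotomic)
    (v : HeightOneSpectrum (𝓞 ℚ)) {m : ℕ} {σ : absoluteGaloisGroup (v.adicCompletion ℚ)}
    (hσ : σ ∈ localSubgroup (κ.layerSubgroup m) (v.adicCompletion ℚ))
    {ζ : AlgebraicClosure (v.adicCompletion ℚ)} (hζ : ζ ^ 2 ^ (m + 2) = 1) :
    σ • ζ = ζ ∨ σ • ζ = ζ⁻¹ := by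
  haveI : CharZero (v.adicCompletion ℚ) :=
    charZero_of_injective_algebraMap (algebraMap ℚ (v.adicCompletion ℚ)).injective
  haveI : NeZero ((2 : ℕ) : v.adicCompletion ℚ) := ⟨by norm_num⟩
  have hspec := GaloisRep.cyclotomicCharacter_spec (v.adicCompletion ℚ) 2 (k := m + 2) σ ζ hζ
  have hζu : IsUnit ζ := IsUnit.of_pow_eq_one hζ (pow_ne_zero _ two_ne_zero)
  haveI : Fact (1 < 2 ^ (m + 2)) := ⟨Nat.one_lt_pow (by omega) (by norm_num)⟩
  rcases toZModPow_cyclotomicCharacter_of_mem_localSubgroup_layerSubgroup hκ v hσ with h | h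
  · left
    rw [hspec, h, ZMod.val_one, pow_one]
  · right
    have hval : (-1 : ZMod (2 ^ (m + 2))).val = 2 ^ (m + 2) - 1 := by
      rw [ZMod.neg_val, if_neg one_ne_zero, ZMod.val_one]
    rw [hspec, h, hval, ← mul_right_inj' hζu.ne_zero]
    rw [← pow_succ', Nat.sub_add_cancel (Nat.one_le_two_pow), hζ, mul_inv_cancel₀ hζu.ne_zero]

/-- **`y_m = ζ + ζ⁻¹ ∈ F_m`**: for every `2^{m+2}`-th root of unity `ζ ∈ K̄_v`, the element `ζ + ζ⁻¹` lies in the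
fixed field `F_m = K̄_v^{H_m}` of the `m`-th local layer subgroup (the local layer field `ℚ_v(ζ_{2^{m+2}})⁺`).
[cite: Washington1997, §13.1] -/
theorem add_inv_mem_fixedField_localSubgroup_layerSubgroup (hκ : κ.IsCyclotomic)
    (v : HeightOneSpectrum (𝓞 ℚ)) (m : ℕ) {ζ : AlgebraicClosure (v.adicCompletion ℚ)}
    (hζ : ζ ^ 2 ^ (m + 2) = 1) :
    ζ + ζ⁻¹ ∈ IntermediateField.fixedField (localSubgroup (κ.layerSubgroup m) (v.adicCompletion ℚ)) := by
  rw [IntermediateField.mem_fixedField_iff]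
  intro σ hσ
  rw [map_add, map_inv₀]
  rcases smul_eq_or_eq_inv_of_mem_localSubgroup_layerSubgroup hκ v hσ hζ with h | h
  · have h' : σ ζ = ζ := h
    rw [h']
  · have h' : σ ζ = ζ⁻¹ := h
    rw [h', inv_inv, add_comm]

/-! ### Local surjectivity of the cyclotomic character modulo `2^k` -/

/-- **Every odd residue is a local cyclotomic character**: for `v ∋ 2` and a unit `c` of `ℤ/2^k`, some
`σ ∈ Γ_{ℚ_v}` has `χ(σ) ≡ c (mod 2^k)` (the tree's `χ₂(I_{ℚ_v}) = ℤ₂ˣ`,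
`adicCompletion_rat_exists_mem_absInertia_cyclotomicCharacter_eq`, at a unit of `ℤ₂` lifting `c`).
[cite: SerreLocalFields1979, Ch. IV §4 Prop. 17] -/
theorem exists_toZModPow_cyclotomicCharacter_eq (v : HeightOneSpectrum (𝓞 ℚ))
    (hv : ((2 : ℕ) : 𝓞 ℚ) ∈ v.asIdeal) (k : ℕ) (c : (ZMod (2 ^ k))ˣ) :
    ∃ σ : absoluteGaloisGroup (v.adicCompletion ℚ),
      toZModPow k ((GaloisRep.cyclotomicCharacter (v.adicCompletion ℚ) 2 σ : ℤ_[2]ˣ) : ℤ_[2]) = c := by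
  have hv' : (Rat.HeightOneSpectrum.primesEquiv v : ℕ) = 2 := by
    have h1 : Rat.HeightOneSpectrum.natGenerator v ∣ 2 := by
      rw [Rat.HeightOneSpectrum.natGenerator_dvd_iff, Ideal.mem_map_of_equiv]
      exact ⟨2, hv, map_natCast _ 2⟩
    exact (Nat.prime_dvd_prime_iff_eq (Rat.HeightOneSpectrum.prime_natGenerator v) Nat.prime_two).mp h1
  -- a `2`-adic unit lifting `c`
  obtain ⟨u, hu⟩ : ∃ u : ℤ_[2]ˣ, toZModPow k (u : ℤ_[2]) = c := by
    rcases Nat.eq_zero_or_pos k with rfl | hk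
    · haveI : Subsingleton (ZMod (2 ^ 0)) := inferInstanceAs (Subsingleton (ZMod 1))
      exact ⟨1, Subsingleton.elim _ _⟩
    set n : ℕ := (c : ZMod (2 ^ k)).val with hn
    have hnodd : ¬ 2 ∣ n := by
      intro hd
      have hcu : IsUnit ((n : ZMod (2 ^ k))) := by rw [hn, ZMod.natCast_zmod_val]; exact c.isUnit
      obtain ⟨e, he⟩ := hd
      rw [he, Nat.cast_mul, Nat.cast_ofNat] at hcu
      have h2 : ¬ IsUnit ((2 : ZMod (2 ^ k))) := by
        rw [show (2 : ZMod (2 ^ k)) = ((2 : ℕ) : ZMod (2 ^ k)) by norm_cast, ZMod.isUnit_iff_coprime,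
          Nat.coprime_pow_right_iff hk, Nat.coprime_self]
        norm_num
      exact h2 (isUnit_of_mul_isUnit_left hcu)
    have hun : IsUnit ((n : ℤ) : ℤ_[2]) := by
      rw [PadicInt.isUnit_iff]
      refine le_antisymm (PadicInt.norm_le_one _) ?_
      by_contra hlt
      rw [not_le, PadicInt.norm_int_lt_one_iff_dvd] at hlt
      exact hnodd (by exact_mod_cast hlt)
    refine ⟨hun.unit, ?_⟩
    rw [IsUnit.unit_spec, map_intCast, Int.cast_natCast, hn, ZMod.natCast_zmod_val]
  obtain ⟨σ, -, hσ⟩ := adicCompletion_rat_exists_mem_absInertia_cyclotomicCharacter_eq (p := 2) (v := v) hv' u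
  exact ⟨σ, by rw [hσ, hu]⟩

/-- **Every `ζ^c`, `c` odd, is a conjugate of `ζ`**: for `v ∋ 2`, `ζ ∈ K̄_v` with `ζ^{2^k} = 1` and a unit `c` of
`ℤ/2^k`, some `σ ∈ Γ_{ℚ_v}` has `σ ζ = ζ^{c}`. [cite: SerreLocalFields1979, Ch. IV §4 Prop. 17] -/
theorem exists_smul_eq_pow (v : HeightOneSpectrum (𝓞 ℚ)) (hv : ((2 : ℕ) : 𝓞 ℚ) ∈ v.asIdeal) (k : ℕ)
    (c : (ZMod (2 ^ k))ˣ) {ζ : AlgebraicClosure (v.adicCompletion ℚ)} (hζ : ζ ^ 2 ^ k = 1) :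
    ∃ σ : absoluteGaloisGroup (v.adicCompletion ℚ), σ • ζ = ζ ^ (c : ZMod (2 ^ k)).val := by
  haveI : CharZero (v.adicCompletion ℚ) :=
    charZero_of_injective_algebraMap (algebraMap ℚ (v.adicCompletion ℚ)).injective
  haveI : NeZero ((2 : ℕ) : v.adicCompletion ℚ) := ⟨by norm_num⟩
  obtain ⟨σ, hσ⟩ := exists_toZModPow_cyclotomicCharacter_eq v hv k c
  refine ⟨σ, ?_⟩
  rw [GaloisRep.cyclotomicCharacter_spec (v.adicCompletion ℚ) 2 (k := k) σ ζ hζ, hσ]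

end Literature.NumberTheory.EllipticCurves.Greenberg1999.MultTowerNS2

end Part3

/-!
## Part 4 — port of `Summits/BirchSwinnertonDyer/BirchSwinnertonDyer/Theorems/ByReductionTypeAtTwoMultTowerNS2LocalLayerGenerator.lean`

# Route `ByReductionTypeAtTwo`, crux `MultUpperHalfAtTwo` (item stmt-BirchSwinnertonDyer-19922), TOWER road, the
# «ONE BIT AT A NON-SPLIT 2» rows: KERNEL BRICK 13b — the local layer field `F_m = ℚ_v(y_m)`, `y_m = ζ_{2^{m+2}} + ζ⁻¹`:
# degree `2^m`, minimal polynomial, and the two norms `N(1 + y_m) = −1`, `N(2 + y_m) = 2`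

HONEST FRAMING (cell `bsd-2adic`, run/shared/lean/pub/bsd-2adic/, seat `bsd-2adic-tower-1` GEN 9, HUMAN RULINGS
D-0036 / D-0054 / D-0074): TOOL theorems only (no definition, no named fact, no `sorry`); closes nothing by itself;
nothing booked; BSD is not proved by any of this. Module M5 of the KERNELISATION of the MEMO binder
`MultTowerNS2.localTowerKerTwoTorsion_le_two_nonsplitTwo_of_tateUnit` (scope memo HOME/tower/SCOPE-hNS2one-kernel-GEN8.md).
For `v ∋ 2`, `K = ℚ_v`, `ζ ∈ K̄_v` a primitive `2^{m+2}`-th root of unity and `y = ζ + ζ⁻¹`: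

* `exists_layerPoly` — the layer polynomials `P_m` (`P_0 = X`, `P_{m+1} = P_m(X² − 2)`): monic of degree `2^m`,
  `P_m(−1) = −1`, `P_m(2) = 2`, `P_m(−2) = 2` (`m ≥ 1`), `P_m(z + z⁻¹) = z^{2^m} + z^{−2^m}`;
* `two_pow_le_finrank_adjoin_add_inv` — `[K(y) : K] ≥ 2^m` (the `2^m` distinct conjugates `ζ^c + ζ^{−c}`, `c` odd
  modulo `±`, BRICK 13a `exists_smul_eq_pow`, are roots of the minimal polynomial);
* `fixedField_localSubgroup_layerSubgroup_eq_adjoin` — **`F_m = K(y)`** and `[K(y) : K] = 2^m` (`y ∈ F_m` by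
  BRICK 13a, `[F_m : K] = 2^m` by BRICK 9); `minpoly_add_inv_eq` — `P_m` is the minimal polynomial of `y`;
* `norm_add_gen_eq` — **`N_{F_m/K}(c + y) = P_m(−c)` for `m ≥ 1`**, whence `N(1 + y) = −1` and `N(2 + y) = 2`
  (`norm_one_add_eq_and_norm_two_add_eq`: `−1` and `2` are norms from every local layer of the cyclotomic
  `ℤ₂`-tower — step S5 of the scope memo).

References: L. Washington, *Introduction to Cyclotomic Fields*, §13.1, Prop. 2.16; scope memo M5/S5.
-/

section Part4

set_option autoImplicit false

open scoped _root_.Classical _root_.IntermediateField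

namespace Literature.NumberTheory.EllipticCurves.Greenberg1999.MultTowerNS2

open _root_.NumberField _root_.IsDedekindDomain _root_.Field _root_.Polynomial _root_.Literature.NumberTheory.EllipticCurves
  _root_.Literature.NumberTheory.GaloisRepresentations

/-! ### The polynomials `P_m` -/

/-- **The layer polynomials.** For every field `K` and `m ≥ 0` there is a monic `P ∈ K[X]` of degree `2^m` with
`P(−1) = −1`, `P(2) = 2`, `P(−2) = 2` when `m ≠ 0`, and `P(z + z⁻¹) = z^{2^m} + z^{−2^m}` for every non-zero `z` in a
field extension (`P_0 = X`, `P_{m+1} = P_m(X² − 2)`; over `ℚ`, `P_m` is the minimal polynomial of `2cos(2π/2^{m+2})`).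
[cite: Washington1997, Prop. 2.16] -/
theorem exists_layerPoly (K : Type*) [Field K] (m : ℕ) :
    ∃ P : K[X], P.Monic ∧ P.natDegree = 2 ^ m ∧ P.eval (-1) = -1 ∧ P.eval 2 = 2 ∧ (m ≠ 0 → P.eval (-2) = 2) ∧
      ∀ (L : Type*) [Field L] [Algebra K L] (z : L), z ≠ 0 → aeval (z + z⁻¹) P = z ^ 2 ^ m + z⁻¹ ^ 2 ^ m := by
  induction m with
  | zero =>
    exact ⟨X, monic_X, by simp, by simp, by simp, fun h ↦ (h rfl).elim, fun L _ _ z _ ↦ by simp⟩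
  | succ m ih =>
    obtain ⟨P, hmon, hdeg, h1, h2, -, hz⟩ := ih
    have hQ : (X ^ 2 - C (2 : K)).Monic := monic_X_pow_sub_C _ two_ne_zero
    have hQd : (X ^ 2 - C (2 : K)).natDegree = 2 := natDegree_X_pow_sub_C
    refine ⟨P.comp (X ^ 2 - C 2), hmon.comp hQ (by rw [hQd]; norm_num), ?_, ?_, ?_, fun _ ↦ ?_, ?_⟩
    · rw [natDegree_comp, hdeg, hQd, pow_succ]
    · rw [eval_comp, eval_sub, eval_pow, eval_X, eval_C]; norm_num; exact h1
    · rw [eval_comp, eval_sub, eval_pow, eval_X, eval_C]; norm_num; exact h2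
    · rw [eval_comp, eval_sub, eval_pow, eval_X, eval_C]; norm_num; exact h2
    · intro L _ _ z hz0
      rw [aeval_comp]
      have hq : aeval (z + z⁻¹) (X ^ 2 - C (2 : K)) = z ^ 2 + (z ^ 2)⁻¹ := by
        rw [map_sub, map_pow, aeval_X, aeval_C, map_ofNat]
        field_simp
        ring
      rw [hq, hz L (z ^ 2) (pow_ne_zero 2 hz0), ← inv_pow, ← pow_mul, ← pow_mul, show 2 * 2 ^ m = 2 ^ (m + 1) by ring]

/-- The value of `P_m` at `y = ζ + ζ⁻¹` for a PRIMITIVE `2^{m+2}`-th root of unity vanishes: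
`ζ^{2^m} = i` with `i² = −1`, so `i + i⁻¹ = 0`. [cite: Washington1997, Prop. 2.16] -/
theorem aeval_add_inv_eq_zero_of_isPrimitiveRoot {K L : Type*} [Field K] [Field L] [Algebra K L] {m : ℕ} {P : K[X]}
    (hP : ∀ z : L, z ≠ 0 → aeval (z + z⁻¹) P = z ^ 2 ^ m + z⁻¹ ^ 2 ^ m) {ζ : L}
    (hζ : IsPrimitiveRoot ζ (2 ^ (m + 2))) : aeval (ζ + ζ⁻¹) P = 0 := by
  have hζ0 : ζ ≠ 0 := hζ.ne_zero (pow_ne_zero _ two_ne_zero)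
  rw [hP ζ hζ0]
  set i := ζ ^ 2 ^ m with hi
  have hi2 : i ^ 2 = -1 := by
    have h4 : (i ^ 2) ^ 2 = 1 := by
      rw [hi, show ((ζ ^ 2 ^ m) ^ 2) ^ 2 = ζ ^ 2 ^ (m + 2) by ring, hζ.pow_eq_one]
    have hne : i ^ 2 ≠ 1 := by
      rw [hi, show (ζ ^ 2 ^ m) ^ 2 = ζ ^ 2 ^ (m + 1) by ring]
      exact hζ.pow_ne_one_of_pos_of_lt (pow_ne_zero _ two_ne_zero)
        (Nat.pow_lt_pow_right (by norm_num) (by omega))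
    rcases sq_eq_one_iff.mp h4 with h | h
    · exact absurd h hne
    · exact h
  have hi0 : i ≠ 0 := pow_ne_zero _ hζ0
  rw [inv_pow, ← hi]
  have : i⁻¹ = -i := inv_eq_of_mul_eq_one_right (by linear_combination -hi2)
  rw [this, add_neg_cancel]

variable {κ : ZpExtension ℚ 2}

/-! ### `[K(y) : K] ≥ 2^m` by counting conjugates, and `F_m = K(y)` -/

/-- **`[ℚ_v(ζ + ζ⁻¹) : ℚ_v] ≥ 2^m`** (`v ∋ 2`, `ζ` a primitive `2^{m+2}`-th root of unity): the conjugates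
`σ(ζ + ζ⁻¹) = ζ^c + ζ^{−c}` (`c` odd, BRICK 13a `exists_smul_eq_pow`) are roots of the minimal polynomial of
`y = ζ + ζ⁻¹`, and `ζ^c + ζ^{−c} = ζ^{c'} + ζ^{−c'}` only for `c' = ±c`: at least `2^{m+1}/2` distinct roots.
[cite: SerreLocalFields1979, Ch. IV §4 Prop. 17] -/
theorem two_pow_le_finrank_adjoin_add_inv (v : HeightOneSpectrum (𝓞 ℚ)) (hv : ((2 : ℕ) : 𝓞 ℚ) ∈ v.asIdeal) (m : ℕ)
    {ζ : AlgebraicClosure (v.adicCompletion ℚ)} (hζ : IsPrimitiveRoot ζ (2 ^ (m + 2))) :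
    2 ^ m ≤ Module.finrank (v.adicCompletion ℚ) (v.adicCompletion ℚ)⟮ζ + ζ⁻¹⟯ := by
  set K := v.adicCompletion ℚ
  set y := ζ + ζ⁻¹ with hy
  have hζ0 : ζ ≠ 0 := hζ.ne_zero (pow_ne_zero _ two_ne_zero)
  have hint : IsIntegral K y := Algebra.IsIntegral.isIntegral y
  rw [IntermediateField.adjoin.finrank hint]
  set P := minpoly K y with hP
  have hP0 : P ≠ 0 := minpoly.ne_zero hint
  -- the conjugates `ζ^c + ζ^{-c}`
  let f : (ZMod (2 ^ (m + 2)))ˣ → AlgebraicClosure K :=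
    fun c ↦ ζ ^ (c : ZMod (2 ^ (m + 2))).val + (ζ ^ (c : ZMod (2 ^ (m + 2))).val)⁻¹
  have hroot : ∀ c, f c ∈ P.rootSet (AlgebraicClosure K) := by
    intro c
    obtain ⟨σ, hσ⟩ := exists_smul_eq_pow v hv (m + 2) c hζ.pow_eq_one
    rw [Polynomial.mem_rootSet_of_ne hP0]
    let σ' : AlgebraicClosure K ≃ₐ[K] AlgebraicClosure K := σ
    have hσy : (σ' : AlgebraicClosure K →ₐ[K] AlgebraicClosure K) y = f c := by
      change σ' (ζ + ζ⁻¹) = _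
      rw [map_add, map_inv₀, show σ' ζ = σ • ζ from rfl, hσ]
    rw [← hσy, Polynomial.aeval_algHom_apply, hP, minpoly.aeval, map_zero]
  -- fibres of `f` have at most two elements `{c, -c}`
  haveI : Fact (1 < 2 ^ (m + 2)) := ⟨Nat.one_lt_pow (by omega) (by norm_num)⟩
  have hfib : ∀ c c' : (ZMod (2 ^ (m + 2)))ˣ, f c = f c' → c' = c ∨ c' = -c := by
    intro c c' h
    set a := ζ ^ (c : ZMod (2 ^ (m + 2))).val with ha
    set b := ζ ^ (c' : ZMod (2 ^ (m + 2))).val with hb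
    have ha0 : a ≠ 0 := pow_ne_zero _ hζ0
    have hb0 : b ≠ 0 := pow_ne_zero _ hζ0
    have h' : a + a⁻¹ = b + b⁻¹ := h
    have hab : (a - b) * (a * b - 1) = 0 := by
      field_simp at h'
      linear_combination h'
    rcases mul_eq_zero.mp hab with h1 | h1
    · left
      have := hζ.pow_inj (ZMod.val_lt _) (ZMod.val_lt _) (sub_eq_zero.mp h1).symm
      exact Units.ext (ZMod.val_injective _ this)
    · right
      have hab1 : ζ ^ ((c : ZMod (2 ^ (m + 2))).val + (c' : ZMod (2 ^ (m + 2))).val) = 1 := by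
        rw [pow_add, ← ha, ← hb]; linear_combination h1
      have hdvd := (hζ.pow_eq_one_iff_dvd _).mp hab1
      have hsum : ((c : ZMod (2 ^ (m + 2))) + (c' : ZMod (2 ^ (m + 2)))) = 0 := by
        rw [← ZMod.natCast_zmod_val (c : ZMod (2 ^ (m + 2))), ← ZMod.natCast_zmod_val (c' : ZMod (2 ^ (m + 2))),
          ← Nat.cast_add, ZMod.natCast_eq_zero_iff]
        exact hdvd
      exact Units.ext (by rw [Units.val_neg]; linear_combination hsum)
  -- counting
  have hcount : (Finset.univ : Finset (ZMod (2 ^ (m + 2)))ˣ).card ≤ 2 * (Finset.univ.image f).card := by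
    refine Finset.card_le_mul_card_image _ 2 fun b hb ↦ ?_
    obtain ⟨c, -, rfl⟩ := Finset.mem_image.mp hb
    calc (Finset.univ.filter fun a ↦ f a = f c).card ≤ ({c, -c} : Finset _).card := by
          refine Finset.card_le_card fun c' hc' ↦ ?_
          rw [Finset.mem_filter] at hc'
          rcases hfib c c' hc'.2.symm with h | h <;> simp [h]
      _ ≤ 2 := Finset.card_le_two
  have huniv : (Finset.univ : Finset (ZMod (2 ^ (m + 2)))ˣ).card = 2 ^ (m + 1) := by
    rw [Finset.card_univ, ZMod.card_units_eq_totient, Nat.totient_prime_pow Nat.prime_two (by omega)]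
    simp
  have himg : (Finset.univ.image f).card ≤ P.natDegree := by
    calc (Finset.univ.image f).card = ((Finset.univ.image f : Finset _) : Set (AlgebraicClosure K)).ncard := by
          rw [Set.ncard_coe_finset]
      _ ≤ (P.rootSet (AlgebraicClosure K)).ncard := by
          refine Set.ncard_le_ncard (fun x hx ↦ ?_) (P.rootSet_finite _)
          obtain ⟨c, -, rfl⟩ := Finset.mem_image.mp (Finset.mem_coe.mp hx)
          exact hroot c
      _ ≤ P.natDegree := P.ncard_rootSet_le _
  have h2 : 2 ^ (m + 1) = 2 * 2 ^ m := by ring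
  omega

/-- **`F_m = ℚ_v(ζ + ζ⁻¹)` and `[ℚ_v(ζ + ζ⁻¹) : ℚ_v] = 2^m`**: for the cyclotomic `ℤ₂`-extension `κ`, `v ∋ 2` and a
primitive `2^{m+2}`-th root of unity `ζ ∈ K̄_v`, the fixed field of the local layer subgroup `H_m` is `K(ζ + ζ⁻¹)`
(`ζ + ζ⁻¹ ∈ F_m` by BRICK 13a, `[F_m : K] = 2^m` by BRICK 9, `[K(ζ + ζ⁻¹) : K] ≥ 2^m`). [cite: Washington1997, §13.1] -/
theorem fixedField_localSubgroup_layerSubgroup_eq_adjoin (hκ : κ.IsCyclotomic) (v : HeightOneSpectrum (𝓞 ℚ))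
    (hv : ((2 : ℕ) : 𝓞 ℚ) ∈ v.asIdeal) (m : ℕ) {ζ : AlgebraicClosure (v.adicCompletion ℚ)}
    (hζ : IsPrimitiveRoot ζ (2 ^ (m + 2))) :
    IntermediateField.fixedField (localSubgroup (κ.layerSubgroup m) (v.adicCompletion ℚ)) =
        (v.adicCompletion ℚ)⟮ζ + ζ⁻¹⟯ ∧
      Module.finrank (v.adicCompletion ℚ) (v.adicCompletion ℚ)⟮ζ + ζ⁻¹⟯ = 2 ^ m := by
  set K := v.adicCompletion ℚ
  set F := IntermediateField.fixedField (localSubgroup (κ.layerSubgroup m) (v.adicCompletion ℚ))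
  haveI : FiniteDimensional K F := finiteDimensional_fixedField_localSubgroup_layerSubgroup (κ := κ) v m
  have hFrank : Module.finrank K F = 2 ^ m := finrank_fixedField_localSubgroup_layerSubgroup hκ v hv m
  have hle : K⟮ζ + ζ⁻¹⟯ ≤ F :=
    IntermediateField.adjoin_simple_le_iff.mpr (add_inv_mem_fixedField_localSubgroup_layerSubgroup hκ v m hζ.pow_eq_one)
  have hup : Module.finrank K K⟮ζ + ζ⁻¹⟯ ≤ 2 ^ m := hFrank ▸ IntermediateField.finrank_le_of_le_right hle
  have hrank : Module.finrank K K⟮ζ + ζ⁻¹⟯ = 2 ^ m := le_antisymm hup (two_pow_le_finrank_adjoin_add_inv v hv m hζ)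
  exact ⟨(IntermediateField.eq_of_le_of_finrank_eq hle (hrank.trans hFrank.symm)).symm, hrank⟩

/-- **The minimal polynomial of `y = ζ + ζ⁻¹` over `ℚ_v` is `P_m`**: any monic `P` of degree `2^m` with
`P(z + z⁻¹) = z^{2^m} + z^{−2^m}` kills `y` and has the degree `[K(y) : K] = 2^m` of the minimal polynomial.
[cite: Washington1997, Prop. 2.16] -/
theorem minpoly_add_inv_eq (hκ : κ.IsCyclotomic) (v : HeightOneSpectrum (𝓞 ℚ)) (hv : ((2 : ℕ) : 𝓞 ℚ) ∈ v.asIdeal)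
    (m : ℕ) {ζ : AlgebraicClosure (v.adicCompletion ℚ)} (hζ : IsPrimitiveRoot ζ (2 ^ (m + 2)))
    {P : (v.adicCompletion ℚ)[X]} (hmon : P.Monic) (hdeg : P.natDegree = 2 ^ m)
    (hP : ∀ z : AlgebraicClosure (v.adicCompletion ℚ), z ≠ 0 → aeval (z + z⁻¹) P = z ^ 2 ^ m + z⁻¹ ^ 2 ^ m) :
    minpoly (v.adicCompletion ℚ) (ζ + ζ⁻¹) = P := by
  set K := v.adicCompletion ℚ
  have hint : IsIntegral K (ζ + ζ⁻¹) := Algebra.IsIntegral.isIntegral _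
  have h0 : aeval (ζ + ζ⁻¹) P = 0 := aeval_add_inv_eq_zero_of_isPrimitiveRoot hP hζ
  have hdvd : minpoly K (ζ + ζ⁻¹) ∣ P := minpoly.dvd K _ h0
  have hdeg' : (minpoly K (ζ + ζ⁻¹)).natDegree = 2 ^ m := by
    rw [← IntermediateField.adjoin.finrank hint, (fixedField_localSubgroup_layerSubgroup_eq_adjoin hκ v hv m hζ).2]
  exact (Polynomial.eq_of_monic_of_dvd_of_natDegree_le (minpoly.monic hint) hmon hdvd (by rw [hdeg, hdeg'])).symm

/-! ### The norms `N(c + y) = P_m(−c)` -/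

/-- **`N_{F_m/ℚ_v}(c + y) = P_m(−c)`** (`m ≥ 1`, `c ∈ ℚ_v`, `y = ζ + ζ⁻¹`, `P_m` its minimal polynomial): `c + y`
generates `F_m`, its minimal polynomial is `P_m(X − c)`, and the norm of a generator is `(−1)^{2^m}` times the
constant coefficient. [cite: Washington1997, Prop. 2.16] -/
theorem norm_add_gen_eq (hκ : κ.IsCyclotomic) (v : HeightOneSpectrum (𝓞 ℚ)) (hv : ((2 : ℕ) : 𝓞 ℚ) ∈ v.asIdeal)
    {m : ℕ} (hm : 1 ≤ m) {ζ : AlgebraicClosure (v.adicCompletion ℚ)} (hζ : IsPrimitiveRoot ζ (2 ^ (m + 2)))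
    (c : v.adicCompletion ℚ) :
    Algebra.norm (v.adicCompletion ℚ)
        (algebraMap (v.adicCompletion ℚ) _ c +
          (⟨ζ + ζ⁻¹, add_inv_mem_fixedField_localSubgroup_layerSubgroup hκ v m hζ.pow_eq_one⟩ :
            IntermediateField.fixedField (localSubgroup (κ.layerSubgroup m) (v.adicCompletion ℚ)))) =
      (minpoly (v.adicCompletion ℚ) (ζ + ζ⁻¹)).eval (-c) := by
  obtain ⟨hFeq, hrank⟩ := fixedField_localSubgroup_layerSubgroup_eq_adjoin hκ v hv m hζ
  have hint : IsIntegral (v.adicCompletion ℚ) (ζ + ζ⁻¹) := Algebra.IsIntegral.isIntegral _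
  haveI : FiniteDimensional (v.adicCompletion ℚ) (v.adicCompletion ℚ)⟮ζ + ζ⁻¹⟯ :=
    IntermediateField.adjoin.finiteDimensional hint
  -- work in `K(y)` with the generator `x = c + y`
  let g : (v.adicCompletion ℚ)⟮ζ + ζ⁻¹⟯ := IntermediateField.AdjoinSimple.gen (v.adicCompletion ℚ) (ζ + ζ⁻¹)
  let x : (v.adicCompletion ℚ)⟮ζ + ζ⁻¹⟯ := algebraMap (v.adicCompletion ℚ) _ c + g
  have hxint : IsIntegral (v.adicCompletion ℚ) x := IsIntegral.of_finite _ x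
  have htop : Algebra.adjoin (v.adicCompletion ℚ) ({x} : Set (v.adicCompletion ℚ)⟮ζ + ζ⁻¹⟯) = ⊤ := by
    have hg : Algebra.adjoin (v.adicCompletion ℚ) ({g} : Set (v.adicCompletion ℚ)⟮ζ + ζ⁻¹⟯) = ⊤ :=
      (IntermediateField.adjoin.powerBasis hint).adjoin_gen_eq_top
    rw [eq_top_iff, ← hg, Algebra.adjoin_le_iff, Set.singleton_subset_iff]
    have hx' : x ∈ Algebra.adjoin (v.adicCompletion ℚ) ({x} : Set (v.adicCompletion ℚ)⟮ζ + ζ⁻¹⟯) :=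
      Algebra.subset_adjoin (Set.mem_singleton x)
    have : g = x - algebraMap (v.adicCompletion ℚ) _ c := by simp [x]
    rw [SetLike.mem_coe, this]
    exact Subalgebra.sub_mem _ hx' (Subalgebra.algebraMap_mem _ c)
  let pb : PowerBasis (v.adicCompletion ℚ) (v.adicCompletion ℚ)⟮ζ + ζ⁻¹⟯ := PowerBasis.ofAdjoinEqTop hxint htop
  have hnormx : Algebra.norm (v.adicCompletion ℚ) x = (minpoly (v.adicCompletion ℚ) (ζ + ζ⁻¹)).eval (-c) := by
    have h := Algebra.PowerBasis.norm_gen_eq_coeff_zero_minpoly pb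
    rw [PowerBasis.ofAdjoinEqTop_gen, PowerBasis.ofAdjoinEqTop_dim] at h
    have hminx : minpoly (v.adicCompletion ℚ) x = (minpoly (v.adicCompletion ℚ) (ζ + ζ⁻¹)).comp (X - C c) := by
      rw [show x = g + algebraMap (v.adicCompletion ℚ) _ c from add_comm _ _, minpoly.add_algebraMap,
        IntermediateField.minpoly_gen]
    rw [h, hminx, natDegree_comp, natDegree_X_sub_C, mul_one, coeff_zero_eq_eval_zero, eval_comp, eval_sub, eval_X,
      eval_C, zero_sub, ← IntermediateField.adjoin.finrank hint, hrank]
    rw [show ((-1 : v.adicCompletion ℚ) ^ 2 ^ m) = 1 from (Even.neg_one_pow ⟨2 ^ (m - 1), by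
      rw [← two_mul, ← pow_succ', Nat.sub_add_cancel hm]⟩), one_mul]
  -- transport along `K(y) = F_m`
  have key : Algebra.norm (v.adicCompletion ℚ) (IntermediateField.equivOfEq hFeq.symm x) =
      (minpoly (v.adicCompletion ℚ) (ζ + ζ⁻¹)).eval (-c) := by
    rw [Algebra.norm_eq_of_algEquiv, hnormx]
  convert key using 2
  apply Subtype.ext
  simp [x, g, IntermediateField.equivOfEq_apply]

/-- **`−1` and `2` are norms from every local layer `F_m` (`m ≥ 1`) of the cyclotomic `ℤ₂`-tower at `v ∋ 2`**:
`N_{F_m/ℚ_v}(1 + y_m) = −1` and `N_{F_m/ℚ_v}(2 + y_m) = 2`, `y_m = ζ_{2^{m+2}} + ζ⁻¹` (`P_m(−1) = −1`, `P_m(−2) = 2`).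
[cite: Washington1997, Prop. 2.16] -/
theorem norm_one_add_eq_and_norm_two_add_eq (hκ : κ.IsCyclotomic) (v : HeightOneSpectrum (𝓞 ℚ))
    (hv : ((2 : ℕ) : 𝓞 ℚ) ∈ v.asIdeal) {m : ℕ} (hm : 1 ≤ m) {ζ : AlgebraicClosure (v.adicCompletion ℚ)}
    (hζ : IsPrimitiveRoot ζ (2 ^ (m + 2))) :
    Algebra.norm (v.adicCompletion ℚ)
        (1 + (⟨ζ + ζ⁻¹, add_inv_mem_fixedField_localSubgroup_layerSubgroup hκ v m hζ.pow_eq_one⟩ :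
          IntermediateField.fixedField (localSubgroup (κ.layerSubgroup m) (v.adicCompletion ℚ)))) = -1 ∧
      Algebra.norm (v.adicCompletion ℚ)
        (2 + (⟨ζ + ζ⁻¹, add_inv_mem_fixedField_localSubgroup_layerSubgroup hκ v m hζ.pow_eq_one⟩ :
          IntermediateField.fixedField (localSubgroup (κ.layerSubgroup m) (v.adicCompletion ℚ)))) = 2 := by
  set K := v.adicCompletion ℚ
  obtain ⟨P, hmon, hdeg, h1, -, h2, hz⟩ := exists_layerPoly K m
  have hmin : minpoly K (ζ + ζ⁻¹) = P := minpoly_add_inv_eq hκ v hv m hζ hmon hdeg (hz _)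
  have hc1 := norm_add_gen_eq hκ v hv hm hζ 1
  have hc2 := norm_add_gen_eq hκ v hv hm hζ 2
  rw [map_one] at hc1
  rw [map_ofNat] at hc2
  rw [hc1, hc2, hmin, h1, h2 (by omega)]
  exact ⟨rfl, rfl⟩

end Literature.NumberTheory.EllipticCurves.Greenberg1999.MultTowerNS2

end Part4

/-!
## Part 5 — port of `Summits/BirchSwinnertonDyer/BirchSwinnertonDyer/Theorems/ByReductionTypeAtTwoMultTowerNS2TwoAdicUnits.lean`

# Route `ByReductionTypeAtTwo`, crux `MultUpperHalfAtTwo` (item stmt-BirchSwinnertonDyer-19922), TOWER road, the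
# «ONE BIT AT A NON-SPLIT 2» rows: KERNEL BRICK 12 — `2`-adic units: `2^m`-th powers by Hensel, the residue of
# `u^{2^{m-1}·a}` for `u ≡ ±3 (mod 8)`, and the index-`2^m` subgroup `⟨2⟩ · ±(1 + 2^{m+2}ℤ₂)` of `ℚ₂ˣ`

HONEST FRAMING (cell `bsd-2adic`, run/shared/lean/pub/bsd-2adic/, seat `bsd-2adic-tower-1` GEN 9, HUMAN RULINGS
D-0036 / D-0054 / D-0074): TOOL theorems only (no definition, no named fact, no `sorry`); closes nothing by itself;
nothing booked; BSD is not proved by any of this. Part of the KERNELISATION of the displayed MEMO binder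
`MultTowerNS2.localTowerKerTwoTorsion_le_two_nonsplitTwo_of_tateUnit` (scope memo HOME/tower/SCOPE-hNS2one-kernel-GEN8.md,
step S5 in the GEN 9 form «the norm group of the `m`-th local layer `ℚ_{2,m} = ℚ₂(ζ_{2^{m+2}} + ζ⁻¹)` is
`⟨2⟩ · ±(1 + 2^{m+2}ℤ₂)`, and `q^{2^{m-1} a} = (2^k u)^{2^{m-1} a}`, `u ≡ ±3 (mod 8)`, `a` odd, is not in it»).
This file is the `2`-adic arithmetic of that statement, in `ℤ_[2]` / `ℚ_[2]`:

* `exists_pow_two_pow_eq_of_toZModPow_eq_one` — **`1 + 2^{m+2}ℤ₂ ⊆ (ℤ₂ˣ)^{2^m}`**: an element `≡ 1 (mod 2^{m+2})`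
  is a `2^m`-th power (Hensel's lemma for `X² − w` at `1`, Mathlib `hensels_lemma`, and induction on `m`);
* `toZModPow_pow_two_pow_mul_of_tateUnit` — for `u ≡ 3, 5 (mod 8)`, `a` odd, `m ≥ 1`:
  `u^{2^{m-1} a} ≡ ±(1 + 2^{m+1}) (mod 2^{m+2})`, hence (`toZModPow_pow_ne_one_and_ne_neg_one_of_tateUnit`)
  `u^{2^{m-1} a} ≢ ±1 (mod 2^{m+2})`;
* `exists_subgroup_twoAdicLayerNorm` — the subgroup `T_m = {2^j w : j ∈ ℤ, w ∈ ℤ₂ˣ, w ≡ ±1 (mod 2^{m+2})}`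
  of `ℚ₂ˣ` exists (stated by its membership predicate) and has index `2^m`.

References: J. Neukirch, *ANT* II (4.6), (5.7), V (1.1); J.-P. Serre, *A Course in Arithmetic*, II §3; scope memo S5.
-/

section Part5

set_option autoImplicit false

open scoped _root_.Classical

namespace Literature.NumberTheory.EllipticCurves.Greenberg1999.MultTowerNS2

open _root_.PadicInt _root_.Polynomial

/-! ### `toZModPow n x = toZModPow n y` as a norm inequality -/

/-- `x ≡ y (mod 2^n)` in `ℤ₂` iff `‖x − y‖ ≤ 2^{−n}`. [folklore] -/
private theorem toZModPow_eq_iff_norm_sub_le (n : ℕ) (x y : ℤ_[2]) :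
    toZModPow n x = toZModPow n y ↔ ‖x - y‖ ≤ (2 : ℝ) ^ (-(n : ℤ)) := by
  rw [← sub_eq_zero, ← map_sub, ← RingHom.mem_ker, ker_toZModPow, ← norm_le_pow_iff_mem_span_pow]
  norm_num

/-- `‖2‖ = 2⁻¹` in `ℤ₂`. [folklore] -/
private theorem norm_two_padicInt : ‖(2 : ℤ_[2])‖ = (2 : ℝ)⁻¹ := by
  have h : ‖((2 : ℕ) : ℤ_[2])‖ = ((2 : ℕ) : ℝ)⁻¹ := norm_p
  simpa using h
/-! ### Hensel: `1 + 8ℤ₂ ⊆ ℤ₂²`, and `1 + 2^{m+2}ℤ₂ ⊆ (ℤ₂)^{2^m}` -/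

/-- **An element of `ℤ₂` congruent to `1 mod 8` is a square**, with a square root `≡ 1 (mod 4)`
(Hensel's lemma for `X² − w` at `a = 1`: `‖1 − w‖ ≤ 1/8 < ‖2‖² = 1/4`). [cite: NeukirchANT1999, Ch. II (5.7) and Lemma (4.6) (Hensel)] -/
theorem exists_sq_eq_of_toZModPow_three_eq_one {w : ℤ_[2]} (hw : toZModPow 3 w = 1) :
    ∃ z : ℤ_[2], z ^ 2 = w ∧ ‖z - 1‖ < ‖(2 : ℤ_[2])‖ := by
  have hw1 : ‖w - 1‖ ≤ (2 : ℝ) ^ (-(3 : ℤ)) := by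
    have h := (toZModPow_eq_iff_norm_sub_le 3 w 1).mp (by rw [hw, map_one])
    exact_mod_cast h
  set F : ℤ_[2][X] := X ^ 2 - C w with hF
  have hFa : F.aeval (1 : ℤ_[2]) = 1 - w := by
    rw [hF]; simp
  have hF' : F.derivative.aeval (1 : ℤ_[2]) = 2 := by
    rw [hF, derivative_sub, derivative_X_pow, derivative_C]; simp
  have hnorm : ‖F.aeval (1 : ℤ_[2])‖ < ‖F.derivative.aeval (1 : ℤ_[2])‖ ^ 2 := by
    rw [hFa, hF', norm_two_padicInt, norm_sub_rev]
    refine hw1.trans_lt ?_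
    norm_num
  obtain ⟨z, hz, hz1, -, -⟩ := hensels_lemma hnorm
  refine ⟨z, ?_, ?_⟩
  · have h : z ^ 2 - w = 0 := by
      have := hz
      rw [hF] at this
      simpa using this
    exact sub_eq_zero.mp h
  · rw [hF'] at hz1
    exact hz1

/-- If `z ≡ 1 (mod 4)` then `‖z² − 1‖ = ‖z − 1‖ · ‖2‖` (`z + 1 = 2·unit`). [folklore] -/
private theorem norm_sq_sub_one_of_norm_sub_one_lt {z : ℤ_[2]} (hz : ‖z - 1‖ < ‖(2 : ℤ_[2])‖) :
    ‖z ^ 2 - 1‖ = ‖z - 1‖ * ‖(2 : ℤ_[2])‖ := by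
  have hfac : z ^ 2 - 1 = (z - 1) * (z + 1) := by ring
  have hz1 : ‖z + 1‖ = ‖(2 : ℤ_[2])‖ := by
    have h : z + 1 = (z - 1) + 2 := by ring
    rw [h]
    rw [PadicInt.norm_add_eq_max_of_ne (ne_of_lt hz), max_eq_right hz.le]
  rw [hfac, norm_mul, hz1]

/-- **`1 + 2^{m+2}ℤ₂ ⊆ (ℤ₂)^{2^m}`**: every `w ≡ 1 (mod 2^{m+2})` in `ℤ₂` is a `2^m`-th power (induction on
`m`: a square root `z ≡ 1 (mod 4)` of `w ≡ 1 (mod 2^{m+3})` has `‖z − 1‖ = ‖w − 1‖/‖2‖ ≤ 2^{−(m+2)}`).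
[folklore] -/
private theorem exists_pow_two_pow_eq_of_toZModPow_eq_one (m : ℕ) {w : ℤ_[2]} (hw : toZModPow (m + 2) w = 1) :
    ∃ w₀ : ℤ_[2], w₀ ^ 2 ^ m = w := by
  induction m generalizing w with
  | zero => exact ⟨w, by simp⟩
  | succ m ih =>
    -- `w ≡ 1 (mod 8)`: a square root `z ≡ 1 (mod 4)`
    have hw3 : toZModPow 3 w = 1 := by
      have h := PadicInt.cast_toZModPow 3 (m + 1 + 2) (by omega) w
      rw [hw, ZMod.cast_one (show 2 ^ 3 ∣ 2 ^ (m + 1 + 2) from pow_dvd_pow 2 (by omega))] at h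
      exact h.symm
    obtain ⟨z, hz, hz1⟩ := exists_sq_eq_of_toZModPow_three_eq_one hw3
    -- `‖z − 1‖ ≤ 2^{−(m+2)}`
    have hwn : ‖w - 1‖ ≤ (2 : ℝ) ^ (-((m + 1 + 2 : ℕ) : ℤ)) :=
      (toZModPow_eq_iff_norm_sub_le _ w 1).mp (by rw [hw, map_one])
    have hzn : ‖z - 1‖ ≤ (2 : ℝ) ^ (-((m + 2 : ℕ) : ℤ)) := by
      have h := norm_sq_sub_one_of_norm_sub_one_lt hz1
      rw [hz, norm_two_padicInt] at h
      have h2 : ‖z - 1‖ = ‖w - 1‖ * 2 := by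
        rw [h]; ring
      rw [h2]
      calc ‖w - 1‖ * 2 ≤ (2 : ℝ) ^ (-((m + 1 + 2 : ℕ) : ℤ)) * 2 := by gcongr
        _ = (2 : ℝ) ^ (-((m + 2 : ℕ) : ℤ)) := by
          rw [show (-((m + 1 + 2 : ℕ) : ℤ)) = -((m + 2 : ℕ) : ℤ) - 1 by push_cast; ring,
            zpow_sub_one₀ (two_ne_zero)]
          ring
    have hzm : toZModPow (m + 2) z = 1 := by
      rw [← map_one (toZModPow (m + 2)), toZModPow_eq_iff_norm_sub_le]
      exact hzn
    obtain ⟨w₀, hw₀⟩ := ih hzm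
    exact ⟨w₀, by rw [pow_succ, pow_mul, hw₀, hz]⟩

/-- The units version: `w ∈ ℤ₂ˣ` with `w ≡ 1 (mod 2^{m+2})` is `w₀^{2^m}` for a unit `w₀`. [folklore] -/
private theorem exists_units_pow_two_pow_eq_of_toZModPow_eq_one (m : ℕ) {w : ℤ_[2]ˣ}
    (hw : toZModPow (m + 2) (w : ℤ_[2]) = 1) : ∃ w₀ : ℤ_[2]ˣ, w₀ ^ 2 ^ m = w := by
  obtain ⟨z, hz⟩ := exists_pow_two_pow_eq_of_toZModPow_eq_one m hw
  have hzu : IsUnit z := by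
    have h2m : 2 ^ m ≠ 0 := pow_ne_zero m two_ne_zero
    exact (isUnit_pow_iff h2m).mp (hz ▸ w.isUnit)
  exact ⟨hzu.unit, Units.ext (by simp [hz])⟩

/-! ### The residue of `u^{2^m a}` modulo `2^{m+3}` for `u ≡ ±3 (mod 8)`, `a` odd -/

/-- For `u ≡ 3, 5 (mod 8)` and `a` odd, `u^a ≡ u (mod 8)`, written as `u^a ≡ ±5 = ±(1 + 4) (mod 8)`. [folklore] -/
private theorem toZModPow_three_pow_odd_of_tateUnit {u : ℤ_[2]} (hu : toZModPow 3 u = 3 ∨ toZModPow 3 u = 5) {a : ℕ}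
    (ha : Odd a) :
    toZModPow 3 (u ^ a) = 1 + 2 ^ 2 ∨ toZModPow 3 (u ^ a) = -(1 + 2 ^ 2) := by
  obtain ⟨j, rfl⟩ := ha
  have key : ∀ t : ZMod (2 ^ 3), (t = 3 ∨ t = 5) → t ^ 2 = 1 := by decide
  rw [map_pow, pow_succ (toZModPow 3 u) (2 * j), pow_mul (toZModPow 3 u) 2 j, key _ hu, one_pow, one_mul]
  rcases hu with h | h <;> rw [h]
  · right; decide
  · left; decide

/-- **`u^{2^m a} ≡ ±(1 + 2^{m+2}) (mod 2^{m+3})`** for `u ≡ 3, 5 (mod 8)`, `a` odd, every `m ≥ 0` (the sign `−`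
occurs only for `m = 0`): induction on `m`, squaring `±(1 + 2^{m+2}) + 2^{m+3} t`. [folklore] -/
private theorem toZModPow_pow_two_pow_mul_of_tateUnit {u : ℤ_[2]} (hu : toZModPow 3 u = 3 ∨ toZModPow 3 u = 5)
    {a : ℕ} (ha : Odd a) (m : ℕ) :
    toZModPow (m + 3) (u ^ (2 ^ m * a)) = 1 + 2 ^ (m + 2) ∨
      toZModPow (m + 3) (u ^ (2 ^ m * a)) = -(1 + 2 ^ (m + 2)) := by
  induction m with
  | zero => simpa using toZModPow_three_pow_odd_of_tateUnit hu ha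
  | succ m ih =>
    set U : ℤ_[2] := u ^ (2 ^ m * a) with hU
    have hsq : u ^ (2 ^ (m + 1) * a) = U ^ 2 := by
      rw [hU, ← pow_mul]; ring_nf
    -- `U = s (1 + 2^{m+2}) + 2^{m+3} t` with `s = ±1`
    obtain ⟨s, hs, hUs⟩ : ∃ s : ℤ_[2], (s = 1 ∨ s = -1) ∧
        toZModPow (m + 3) U = toZModPow (m + 3) (s * (1 + 2 ^ (m + 2))) := by
      rcases ih with h | h
      · exact ⟨1, Or.inl rfl, by rw [h, one_mul, map_add, map_one, map_pow, map_ofNat]⟩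
      · exact ⟨-1, Or.inr rfl, by rw [h, neg_one_mul, map_neg, map_add, map_one, map_pow, map_ofNat]⟩
    have hker : U - s * (1 + 2 ^ (m + 2)) ∈ RingHom.ker (toZModPow (p := 2) (m + 3)) := by
      rw [RingHom.mem_ker, map_sub, hUs, sub_self]
    rw [ker_toZModPow, Ideal.mem_span_singleton] at hker
    obtain ⟨t, ht⟩ := hker
    have hss : s ^ 2 = 1 := by rcases hs with rfl | rfl <;> norm_num
    -- `U² = 1 + 2^{m+3} + 2^{m+4}·(…)`
    have hU2 : U ^ 2 - (1 + 2 ^ (m + 3)) =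
        (2 : ℤ_[2]) ^ (m + 4) * (2 ^ m + s * (1 + 2 ^ (m + 2)) * t + 2 ^ (m + 2) * t ^ 2) := by
      have hUe : U = s * (1 + 2 ^ (m + 2)) + 2 ^ (m + 3) * t := by
        linear_combination ht
      rw [hUe]
      ring_nf
      rw [hss]
      ring
    have hker2 : U ^ 2 - (1 + 2 ^ (m + 3)) ∈ RingHom.ker (toZModPow (p := 2) (m + 1 + 3)) := by
      rw [ker_toZModPow, Ideal.mem_span_singleton, hU2, show m + 1 + 3 = m + 4 by ring]
      exact dvd_mul_right _ _
    rw [RingHom.mem_ker, map_sub, sub_eq_zero] at hker2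
    left
    rw [hsq, hker2, show m + 1 + 2 = m + 3 by ring, map_add, map_one, map_pow, map_ofNat]

/-- In `ℤ/2^{m+3}`: `1 + 2^{m+2} ≠ ±1` and `−(1 + 2^{m+2}) ≠ ±1`. [folklore] -/
private theorem one_add_two_pow_ne_one_and_ne_neg_one (m : ℕ) :
    ((1 + 2 ^ (m + 2) : ZMod (2 ^ (m + 3))) ≠ 1 ∧ (1 + 2 ^ (m + 2) : ZMod (2 ^ (m + 3))) ≠ -1) ∧
      ((-(1 + 2 ^ (m + 2)) : ZMod (2 ^ (m + 3))) ≠ 1 ∧ (-(1 + 2 ^ (m + 2)) : ZMod (2 ^ (m + 3))) ≠ -1) := by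
  have h1 : (2 ^ (m + 2) : ZMod (2 ^ (m + 3))) ≠ 0 := by
    intro h
    have h' : ((2 ^ (m + 2) : ℕ) : ZMod (2 ^ (m + 3))) = 0 := by exact_mod_cast h
    rw [ZMod.natCast_eq_zero_iff] at h'
    have := Nat.le_of_dvd (by positivity) h'
    have hlt : 2 ^ (m + 2) < 2 ^ (m + 3) := Nat.pow_lt_pow_right (by norm_num) (by omega)
    omega
  have h2 : (2 + 2 ^ (m + 2) : ZMod (2 ^ (m + 3))) ≠ 0 := by
    intro h
    have h' : ((2 + 2 ^ (m + 2) : ℕ) : ZMod (2 ^ (m + 3))) = 0 := by exact_mod_cast h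
    rw [ZMod.natCast_eq_zero_iff] at h'
    have := Nat.le_of_dvd (by positivity) h'
    have hlt : 2 + 2 ^ (m + 2) < 2 ^ (m + 3) := by
      have h4 : 4 ≤ 2 ^ (m + 2) := by
        calc (4 : ℕ) = 2 ^ 2 := by norm_num
          _ ≤ 2 ^ (m + 2) := Nat.pow_le_pow_right (by norm_num) (by omega)
      have h5 : 2 ^ (m + 3) = 2 ^ (m + 2) * 2 := pow_succ 2 (m + 2)
      omega
    omega
  refine ⟨⟨fun h ↦ h1 (by linear_combination h), fun h ↦ h2 (by linear_combination h)⟩,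
    ⟨fun h ↦ h2 (by linear_combination -h), fun h ↦ h1 (by linear_combination -h)⟩⟩

/-- **`u^{2^m a} ≢ ±1 (mod 2^{m+3})`** for `u ∈ ℤ₂` with `u ≡ 3, 5 (mod 8)` and `a` odd — the unit part of
`q^{2^m a}`, `q = 2^k u` the Tate parameter, is NOT `≡ ±1 (mod 2^{m+3})`, i.e. `q^{2^m a}` lies outside
`⟨2⟩ · ±(1 + 2^{m+3}ℤ₂) = N(ℚ_{2,m+1}ˣ)`. [folklore] -/
private theorem toZModPow_pow_ne_one_and_ne_neg_one_of_tateUnit {u : ℤ_[2]}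
    (hu : toZModPow 3 u = 3 ∨ toZModPow 3 u = 5) {a : ℕ} (ha : Odd a) (m : ℕ) :
    toZModPow (m + 3) (u ^ (2 ^ m * a)) ≠ 1 ∧ toZModPow (m + 3) (u ^ (2 ^ m * a)) ≠ -1 := by
  obtain ⟨⟨h1, h2⟩, ⟨h3, h4⟩⟩ := one_add_two_pow_ne_one_and_ne_neg_one m
  rcases toZModPow_pow_two_pow_mul_of_tateUnit hu ha m with h | h <;> rw [h]
  · exact ⟨h1, h2⟩
  · exact ⟨h3, h4⟩
/-! ### `ℚ₂ˣ = 2^ℤ × ℤ₂ˣ` and the index-`2^m` subgroup `⟨2⟩ · ±(1 + 2^{m+2}ℤ₂)` -/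

/-- `‖2^j‖ = 2^{−j}` in `ℚ₂`. [folklore] -/
private theorem norm_two_zpow_padic (j : ℤ) : ‖(2 : ℚ_[2]) ^ j‖ = (2 : ℝ) ^ (-j) := by
  rw [norm_zpow, show ((2 : ℚ_[2]) = ((2 : ℕ) : ℚ_[2])) by norm_cast, Padic.norm_p]
  rw [show ((2 : ℕ) : ℝ)⁻¹ = (2 : ℝ) ^ (-1 : ℤ) by norm_num, ← zpow_mul]
  ring_nf

/-- **`ℚ₂ˣ = 2^ℤ · ℤ₂ˣ`**: every non-zero `x ∈ ℚ₂` is `2^j · w` with `j ∈ ℤ` and `w ∈ ℤ₂ˣ`. [folklore] -/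
private theorem exists_eq_two_zpow_mul_units (x : ℚ_[2]) (hx : x ≠ 0) :
    ∃ (j : ℤ) (w : ℤ_[2]ˣ), x = (2 : ℚ_[2]) ^ j * ((w : ℤ_[2]) : ℚ_[2]) := by
  have h2 : (2 : ℚ_[2]) ≠ 0 := by norm_num
  set j : ℤ := x.valuation with hj
  have hw : ‖x * (2 : ℚ_[2]) ^ (-j)‖ = 1 := by
    rw [norm_mul, norm_two_zpow_padic, neg_neg, Padic.norm_eq_zpow_neg_valuation hx, ← hj,
      show (((2 : ℕ) : ℝ)) = (2 : ℝ) by norm_num, ← zpow_add₀ (by norm_num : (2 : ℝ) ≠ 0)]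
    simp
  refine ⟨j, PadicInt.mkUnits hw, ?_⟩
  rw [PadicInt.mkUnits_eq, mul_comm, mul_assoc, ← zpow_add₀ h2, neg_add_cancel, zpow_zero, mul_one]

/-- Uniqueness of `x = 2^j · w`: the exponent and the unit are determined. [folklore] -/
private theorem two_zpow_mul_units_inj {j j' : ℤ} {w w' : ℤ_[2]ˣ}
    (h : (2 : ℚ_[2]) ^ j * ((w : ℤ_[2]) : ℚ_[2]) = (2 : ℚ_[2]) ^ j' * ((w' : ℤ_[2]) : ℚ_[2])) :
    j = j' ∧ w = w' := by
  have h2 : (2 : ℚ_[2]) ≠ 0 := by norm_num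
  have hn := congrArg (fun z : ℚ_[2] ↦ ‖z‖) h
  simp only [norm_mul, norm_two_zpow_padic] at hn
  rw [show ‖((w : ℤ_[2]) : ℚ_[2])‖ = 1 from PadicInt.norm_units w,
    show ‖((w' : ℤ_[2]) : ℚ_[2])‖ = 1 from PadicInt.norm_units w', mul_one, mul_one] at hn
  have hjj : j = j' := by
    have := zpow_right_injective₀ (by norm_num : (0 : ℝ) < 2) (by norm_num : (2 : ℝ) ≠ 1) hn
    linarith
  subst hjj
  refine ⟨rfl, ?_⟩
  have hw := mul_left_cancel₀ (zpow_ne_zero j h2) h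
  exact Units.ext (Subtype.ext hw)

/-- **The subgroup `T_m = ⟨2⟩ · ±(1 + 2^{m+2}ℤ₂)` of `ℚ₂ˣ` and its index `2^m`.** There is a subgroup of
`ℚ₂ˣ` whose elements are exactly the `2^j · w`, `j ∈ ℤ`, `w ∈ ℤ₂ˣ` with `w ≡ ±1 (mod 2^{m+2})`, and it has index
`2^m` (it is the kernel of `ℚ₂ˣ → ℤ₂ˣ → (ℤ/2^{m+2})ˣ/±1`, a surjection onto a group of order `2^{m+1}/2`). It is the
norm group of the `m`-th layer `ℚ₂(ζ_{2^{m+2}} + ζ⁻¹)` of the cyclotomic `ℤ₂`-extension (BRICK 14).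
[cite: NeukirchANT1999, Ch. II (5.7), Ch. V (1.1)] -/
theorem exists_subgroup_twoAdicLayerNorm (m : ℕ) :
    ∃ T : Subgroup ℚ_[2]ˣ,
      (∀ x : ℚ_[2]ˣ, x ∈ T ↔ ∃ (j : ℤ) (w : ℤ_[2]ˣ),
        (toZModPow (m + 2) (w : ℤ_[2]) = 1 ∨ toZModPow (m + 2) (w : ℤ_[2]) = -1) ∧
          (x : ℚ_[2]) = (2 : ℚ_[2]) ^ j * ((w : ℤ_[2]) : ℚ_[2])) ∧
      T.index = 2 ^ m := by
  have h2 : (2 : ℚ_[2]) ≠ 0 := by norm_num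
  -- the unit-part homomorphism `ℚ₂ˣ → ℤ₂ˣ`
  have hdec : ∀ x : ℚ_[2]ˣ, ∃ (j : ℤ) (w : ℤ_[2]ˣ), (x : ℚ_[2]) = (2 : ℚ_[2]) ^ j * ((w : ℤ_[2]) : ℚ_[2]) :=
    fun x ↦ exists_eq_two_zpow_mul_units (x : ℚ_[2]) x.ne_zero
  choose jv wv hjw using hdec
  let υ : ℚ_[2]ˣ →* ℤ_[2]ˣ :=
    { toFun := wv
      map_one' := by
        have h := hjw 1
        rw [Units.val_one, show (1 : ℚ_[2]) = (2 : ℚ_[2]) ^ (0 : ℤ) * (((1 : ℤ_[2]ˣ) : ℤ_[2]) : ℚ_[2])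
          by simp] at h
        exact (two_zpow_mul_units_inj h).2.symm
      map_mul' := fun x y ↦ by
        have h := hjw (x * y)
        rw [Units.val_mul, hjw x, hjw y, show (2 : ℚ_[2]) ^ jv x * ((wv x : ℤ_[2]) : ℚ_[2]) *
            ((2 : ℚ_[2]) ^ jv y * ((wv y : ℤ_[2]) : ℚ_[2])) =
            (2 : ℚ_[2]) ^ (jv x + jv y) * (((wv x * wv y : ℤ_[2]ˣ) : ℤ_[2]) : ℚ_[2]) by
          rw [zpow_add₀ h2]; push_cast; ring] at h
        exact (two_zpow_mul_units_inj h).2.symm }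
  have hυ : ∀ (x : ℚ_[2]ˣ) (j : ℤ) (w : ℤ_[2]ˣ),
      (x : ℚ_[2]) = (2 : ℚ_[2]) ^ j * ((w : ℤ_[2]) : ℚ_[2]) → υ x = w := by
    intro x j w h
    rw [hjw x] at h
    exact (two_zpow_mul_units_inj h).2
  -- reduction modulo `2^{m+2}` and the sign subgroup `{±1}`
  let ρ : ℤ_[2]ˣ →* (ZMod (2 ^ (m + 2)))ˣ := Units.map (toZModPow (p := 2) (m + 2)).toMonoidHom
  let N : Subgroup (ZMod (2 ^ (m + 2)))ˣ := (Units.map (Int.castRingHom (ZMod (2 ^ (m + 2)))).toMonoidHom).range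
  have hN : ∀ c : (ZMod (2 ^ (m + 2)))ˣ, c ∈ N ↔ (c : ZMod (2 ^ (m + 2))) = 1 ∨ (c : ZMod (2 ^ (m + 2))) = -1 := by
    intro c
    constructor
    · rintro ⟨e, rfl⟩
      rcases Int.units_eq_one_or e with rfl | rfl
      · left; simp
      · right; simp
    · rintro (h | h)
      · exact ⟨1, Units.ext (by simpa using h.symm)⟩
      · exact ⟨-1, Units.ext (by simpa using h.symm)⟩
  haveI : N.Normal := inferInstance
  let ψ : ℚ_[2]ˣ →* (ZMod (2 ^ (m + 2)))ˣ ⧸ N := (QuotientGroup.mk' N).comp (ρ.comp υ)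
  refine ⟨ψ.ker, fun x ↦ ?_, ?_⟩
  · -- membership
    rw [MonoidHom.mem_ker]
    change (QuotientGroup.mk' N) (ρ (υ x)) = 1 ↔ _
    rw [QuotientGroup.mk'_apply, QuotientGroup.eq_one_iff, hN]
    have hρ : ∀ w : ℤ_[2]ˣ, ((ρ w : (ZMod (2 ^ (m + 2)))ˣ) : ZMod (2 ^ (m + 2))) =
        toZModPow (m + 2) (w : ℤ_[2]) := fun w ↦ rfl
    rw [hρ]
    constructor
    · intro h
      exact ⟨jv x, υ x, h, hjw x⟩
    · rintro ⟨j, w, hw, hx⟩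
      rwa [hυ x j w hx]
  · -- index
    have hsurj : Function.Surjective ψ := by
      intro c
      obtain ⟨c, rfl⟩ := QuotientGroup.mk_surjective c
      -- lift `c` to an odd natural number
      set n : ℕ := (c : ZMod (2 ^ (m + 2))).val with hn
      have hnodd : ¬ 2 ∣ n := by
        intro hd
        have hu : IsUnit ((n : ZMod (2 ^ (m + 2)))) := by
          rw [hn, ZMod.natCast_zmod_val]; exact c.isUnit
        have h2u : IsUnit ((2 : ZMod (2 ^ (m + 2)))) := by
          obtain ⟨k, hk⟩ := hd
          rw [hk, Nat.cast_mul, Nat.cast_ofNat] at hu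
          exact isUnit_of_mul_isUnit_left hu
        have hnot : ¬ IsUnit ((2 : ZMod (2 ^ (m + 2)))) := by
          rw [show (2 : ZMod (2 ^ (m + 2))) = ((2 : ℕ) : ZMod (2 ^ (m + 2))) by norm_cast,
            ZMod.isUnit_iff_coprime]
          rw [Nat.coprime_pow_right_iff (by omega : 0 < m + 2), Nat.coprime_self]
          norm_num
        exact hnot h2u
      have hwn : ‖((n : ℤ) : ℤ_[2])‖ = 1 := by
        refine le_antisymm (PadicInt.norm_le_one _) ?_
        by_contra hlt
        rw [not_le, PadicInt.norm_int_lt_one_iff_dvd] at hlt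
        exact hnodd (by exact_mod_cast hlt)
      let w : ℤ_[2]ˣ := PadicInt.mkUnits (u := ((n : ℤ) : ℚ_[2])) (by
        rw [show (((n : ℤ) : ℚ_[2])) = (((n : ℤ) : ℤ_[2]) : ℚ_[2]) by norm_cast]; exact hwn)
      have hw0 : ((w : ℤ_[2]) : ℚ_[2]) ≠ 0 := by
        rw [PadicInt.mkUnits_eq]; exact_mod_cast fun h ↦ hnodd (by rw [h]; exact dvd_zero 2)
      let x : ℚ_[2]ˣ := Units.mk0 _ hw0
      refine ⟨x, ?_⟩
      have hx : υ x = w := hυ x 0 w (by simp [x])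
      change (QuotientGroup.mk' N) (ρ (υ x)) = _
      rw [hx, QuotientGroup.mk'_apply]
      congr 1
      apply Units.ext
      change toZModPow (m + 2) (w : ℤ_[2]) = (c : ZMod (2 ^ (m + 2)))
      have hwval : (w : ℤ_[2]) = ((n : ℤ) : ℤ_[2]) := by
        apply Subtype.ext
        rw [PadicInt.mkUnits_eq]
        norm_cast
      rw [hwval, map_intCast, Int.cast_natCast, hn, ZMod.natCast_zmod_val]
    -- counting: `#(ℤ/2^{m+2})ˣ = 2^{m+1}`, `#N = 2`
    haveI : Fact (1 < 2 ^ (m + 2)) := ⟨Nat.one_lt_pow (by omega) (by norm_num)⟩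
    haveI : Fact (2 < 2 ^ (m + 2)) := ⟨by
      calc (2 : ℕ) < 2 ^ 2 := by norm_num
        _ ≤ 2 ^ (m + 2) := Nat.pow_le_pow_right (by norm_num) (by omega)⟩
    have hcardG : Nat.card (ZMod (2 ^ (m + 2)))ˣ = 2 ^ (m + 1) := by
      rw [Nat.card_eq_fintype_card, ZMod.card_units_eq_totient, Nat.totient_prime_pow Nat.prime_two (by omega)]
      simp
    have hcardN : Nat.card N = 2 := by
      have hNeq : (N : Set (ZMod (2 ^ (m + 2)))ˣ) = {1, -1} := by
        ext c
        rw [SetLike.mem_coe, hN, Set.mem_insert_iff, Set.mem_singleton_iff]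
        constructor
        · rintro (h | h)
          · left; exact Units.ext (by simpa using h)
          · right; exact Units.ext (by simpa using h)
        · rintro (rfl | rfl)
          · left; simp
          · right; simp
      rw [← SetLike.coe_sort_coe, hNeq, Nat.card_coe_set_eq, Set.ncard_pair]
      intro h
      have h' := congrArg (fun c : (ZMod (2 ^ (m + 2)))ˣ ↦ (c : ZMod (2 ^ (m + 2)))) h
      simp only [Units.val_one, Units.val_neg] at h'
      exact ZMod.neg_one_ne_one h'.symm
    have hquot : Nat.card ((ZMod (2 ^ (m + 2)))ˣ ⧸ N) = 2 ^ m := by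
      have h := Subgroup.card_eq_card_quotient_mul_card_subgroup N
      rw [hcardG, hcardN, pow_succ] at h
      linarith
    rw [Subgroup.index_ker, MonoidHom.range_eq_top.mpr hsurj, Subgroup.card_top, hquot]

end Literature.NumberTheory.EllipticCurves.Greenberg1999.MultTowerNS2

end Part5

/-!
## Part 6 — port of `Summits/BirchSwinnertonDyer/BirchSwinnertonDyer/Theorems/ByReductionTypeAtTwoMultTowerNS2LayerNormGroup.lean`

# Route `ByReductionTypeAtTwo`, crux `MultUpperHalfAtTwo` (item stmt-BirchSwinnertonDyer-19922), TOWER road, the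
# «ONE BIT AT A NON-SPLIT 2» rows: KERNEL BRICK 14 — the norm group of the local layer `F_m` of the cyclotomic
# `ℤ₂`-tower is `⟨2⟩ · ±(1 + 2^{m+2}ℤ₂)`, and `q^{2^{m−1}a} = (2^k u)^{2^{m−1}a}` (`u ≡ ±3 mod 8`, `a` odd) is NOT a norm

HONEST FRAMING (cell `bsd-2adic`, run/shared/lean/pub/bsd-2adic/, seat `bsd-2adic-tower-1` GEN 9, HUMAN RULINGS
D-0036 / D-0054 / D-0074): TOOL theorems only (no definition, no named fact, no `sorry`); closes nothing by itself;
nothing booked; BSD is not proved by any of this. Step S5 of the KERNELISATION of the MEMO binder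
`MultTowerNS2.localTowerKerTwoTorsion_le_two_nonsplitTwo_of_tateUnit` (scope memo HOME/tower/SCOPE-hNS2one-kernel-GEN8.md),
in the CFT-light form found by GEN 9: for `v ∋ 2`, `K = ℚ_v`, the local layer field `F_m = K̄_v^{H_m}` (`m ≥ 1`):

* `isGalois_fixedField_localSubgroup_layerSubgroup`, `isCyclic_gal_fixedField_localSubgroup_layerSubgroup` —
  `F_m/K` is Galois with cyclic group (`Γ_{ℚ_v}/H_m ≅ ℤ₂/2^mℤ₂` by BRICK 8's surjectivity of `κ ∘ res_v`);
* `index_range_norm_fixedField_layer` — `[Kˣ : N(F_mˣ)] = 2^m`, the tree's CLASS FIELD AXIOM for cyclic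
  extensions of a local field (`index_range_norm_eq_finrank_of_isCyclic`, Neukirch V (1.1), PROVED in the tree);
* `mem_range_norm_fixedField_layer_iff` — **`N(F_mˣ) = ⟨2⟩ · ±(1 + 2^{m+2}ℤ₂)`** read through any ring
  isomorphism `e : K ≃+* ℚ₂`: `x` is a norm from `F_m` iff `e x = 2^j w` with `w ∈ ℤ₂ˣ`, `w ≡ ±1 (mod 2^{m+2})`.
  Proof: `⊇` from `−1 = N(1 + y_m)`, `2 = N(2 + y_m)` (BRICK 13b) and `1 + 2^{m+2}ℤ₂ ⊆ (ℤ₂ˣ)^{2^m}` (BRICK 12,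
  `z^{2^m} = N(z)`); equality since both subgroups have index `2^m` (BRICK 12 `exists_subgroup_twoAdicLayerNorm`);
* `norm_ne_pow_of_tateUnit` — **for `q ∈ K` with `e q = 2^k u`, `u ≡ 3, 5 (mod 8)`, `a` odd and every `f ∈ F_m`:
  `N_{F_m/K}(f) ≠ q^{2^{m−1} a}`** (its unit part is `≡ ±(1 + 2^{m+1}) ≢ ±1 (mod 2^{m+2})`, BRICK 12) — the
  tower non-norm lemma at level `0`; the relative form `q^{2^{r−1}a} ∉ N(F_{n+r}/F_n)` follows by transitivity
  of the norm (consumer files).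

References: J. Neukirch, *ANT* V (1.1), II (5.7); J.-P. Serre, *Local Fields* XIV §7; scope memo S5.
-/

section Part6

set_option autoImplicit false

open scoped _root_.Classical _root_.IntermediateField

namespace Literature.NumberTheory.EllipticCurves.Greenberg1999.MultTowerNS2

open _root_.NumberField _root_.IsDedekindDomain _root_.Field _root_.PadicInt _root_.Literature.NumberTheory.EllipticCurves
  _root_.Literature.NumberTheory.GaloisRepresentations

/-- Two subgroups `T ≤ S` of the same finite index are equal. [folklore] -/
private theorem subgroup_eq_of_le_of_index_eq {G : Type*} [Group G] {T S : Subgroup G} (h : T ≤ S)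
    (hidx : T.index = S.index) (h0 : S.index ≠ 0) : T = S := by
  refine le_antisymm h ?_
  have hmul := Subgroup.relIndex_mul_index h
  rw [hidx] at hmul
  have hrel : T.relIndex S = 1 := by
    have : T.relIndex S * S.index = 1 * S.index := by rw [hmul, one_mul]
    exact mul_right_cancel₀ h0 this
  exact Subgroup.relIndex_eq_one.mp hrel

variable {κ : ZpExtension ℚ 2}

/-! ### `F_m / ℚ_v` is cyclic of degree `2^m` -/

/-- **`F_m/ℚ_v` is Galois**: `H_m` is an open normal subgroup of `Γ_{ℚ_v}` (preimage of the normal subgroup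
`κ⁻¹(2^mℤ₂)`), and the fixing subgroup of its fixed field is `H_m` itself. [cite: Washington1997, §13.1] -/
theorem isGalois_fixedField_localSubgroup_layerSubgroup (v : HeightOneSpectrum (𝓞 ℚ)) (m : ℕ) :
    IsGalois (v.adicCompletion ℚ)
      (IntermediateField.fixedField (localSubgroup (κ.layerSubgroup m) (v.adicCompletion ℚ))) := by
  -- (all terms mentioning `localSubgroup` are built BEFORE a `CharZero ℚ_v` instance enters the context: with it,
  -- `Algebra ℚ ℚ_v` would resolve to `DivisionRing.toRatAlgebra` instead of the completion's algebra structure)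
  have hopen := isOpen_localSubgroup (κ.layerSubgroup m) (κ.isOpen_layerSubgroup m) (v.adicCompletion ℚ)
  have hnormal : (localSubgroup (κ.layerSubgroup m) (v.adicCompletion ℚ)).Normal := by
    rw [localSubgroup_eq_comap]; exact Subgroup.Normal.comap inferInstance _
  haveI : CharZero (v.adicCompletion ℚ) :=
    charZero_of_injective_algebraMap (algebraMap ℚ (v.adicCompletion ℚ)).injective
  have hfix := fixingSubgroup_fixedField_of_isOpen _ hopen
  have key := fun x ↦ SetLike.ext_iff.mp hfix x
  refine (InfiniteGalois.normal_iff_isGalois _).mp ?_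
  exact ⟨fun a ha b ↦ (key _).mpr (hnormal.conj_mem a ((key a).mp ha) b)⟩

/-- **`Gal(F_m/ℚ_v)` is cyclic**: it is `Γ_{ℚ_v}/H_m ≅ ℤ₂/2^m ℤ₂ ≅ ℤ/2^m` (`κ ∘ res_v` is onto, BRICK 8; Krull:
`Gal(K̄^H/K) ≅ Γ/H` for closed normal `H`, Mathlib `InfiniteGalois.normalAutEquivQuotient`).
[cite: Washington1997, §13.1] -/
theorem isCyclic_gal_fixedField_localSubgroup_layerSubgroup (hκ : κ.IsCyclotomic) (v : HeightOneSpectrum (𝓞 ℚ))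
    (hv : ((2 : ℕ) : 𝓞 ℚ) ∈ v.asIdeal) (m : ℕ) :
    IsCyclic (IntermediateField.fixedField (localSubgroup (κ.layerSubgroup m) (v.adicCompletion ℚ)) ≃ₐ[v.adicCompletion ℚ]
      IntermediateField.fixedField (localSubgroup (κ.layerSubgroup m) (v.adicCompletion ℚ))) := by
  have hopen : IsOpen (localSubgroup (κ.layerSubgroup m) (v.adicCompletion ℚ) :
      Set (absoluteGaloisGroup (v.adicCompletion ℚ))) :=
    isOpen_localSubgroup (κ.layerSubgroup m) (κ.isOpen_layerSubgroup m) (v.adicCompletion ℚ)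
  have hnormal : (localSubgroup (κ.layerSubgroup m) (v.adicCompletion ℚ)).Normal := by
    rw [localSubgroup_eq_comap]; exact Subgroup.Normal.comap inferInstance _
  have hclosed := (localSubgroup (κ.layerSubgroup m) (v.adicCompletion ℚ)).isClosed_of_isOpen hopen
  -- `H_m = ker (Γ_{ℚ_v} → ℤ₂ → ℤ/2^m)`, a surjection
  let φ : absoluteGaloisGroup (v.adicCompletion ℚ) →* Multiplicative (ZMod (2 ^ m)) :=
    (AddMonoidHom.toMultiplicative (toZModPow (p := 2) m).toAddMonoidHom).comp
      (κ.toContinuousMonoidHom.toMonoidHom.comp (resGal (K := ℚ) (v.adicCompletion ℚ)).toMonoidHom)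
  have hφ : Function.Surjective φ := by
    intro c
    obtain ⟨t, ht⟩ := ZMod.ringHom_surjective (toZModPow (p := 2) m) c.toAdd
    obtain ⟨σ, hσ⟩ := surjective_kappa_comp_resGal hκ v hv (Multiplicative.ofAdd t)
    refine ⟨σ, ?_⟩
    change Multiplicative.ofAdd (toZModPow m (Multiplicative.toAdd
      ((κ.toContinuousMonoidHom.toMonoidHom.comp (resGal (K := ℚ) (v.adicCompletion ℚ)).toMonoidHom) σ))) = c
    rw [hσ, toAdd_ofAdd, ht, ofAdd_toAdd]
  have hker : φ.ker = localSubgroup (κ.layerSubgroup m) (v.adicCompletion ℚ) := by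
    ext σ
    rw [MonoidHom.mem_ker, mem_localSubgroup_iff, ZpExtension.mem_layerSubgroup, ← Ideal.mem_span_singleton,
      ← ker_toZModPow, RingHom.mem_ker]
    constructor
    · intro h
      exact congrArg Multiplicative.toAdd h
    · intro h
      exact congrArg Multiplicative.ofAdd h
  have hcyc0 : IsCyclic (absoluteGaloisGroup (v.adicCompletion ℚ) ⧸ φ.ker) :=
    isCyclic_of_surjective _ (QuotientGroup.quotientKerEquivOfSurjective φ hφ).symm.surjective
  -- the closed normal subgroup `H_m` of `Gal(K̄_v/ℚ_v)` and Krull's `Gal(F_m/ℚ_v) ≅ Γ/H_m`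
  let Hc : ClosedSubgroup (AlgebraicClosure (v.adicCompletion ℚ) ≃ₐ[v.adicCompletion ℚ]
      AlgebraicClosure (v.adicCompletion ℚ)) := ⟨localSubgroup (κ.layerSubgroup m) (v.adicCompletion ℚ), hclosed⟩
  haveI hN : Hc.toSubgroup.Normal := hnormal
  haveI hC : IsCyclic ((AlgebraicClosure (v.adicCompletion ℚ) ≃ₐ[v.adicCompletion ℚ]
      AlgebraicClosure (v.adicCompletion ℚ)) ⧸ Hc.toSubgroup) :=
    isCyclic_of_surjective _ (QuotientGroup.quotientMulEquivOfEq hker).surjective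
  haveI : CharZero (v.adicCompletion ℚ) :=
    charZero_of_injective_algebraMap (algebraMap ℚ (v.adicCompletion ℚ)).injective
  exact isCyclic_of_surjective _ (InfiniteGalois.normalAutEquivQuotient Hc).surjective

/-- **`[ℚ_vˣ : N(F_mˣ)] = 2^m`** — the CLASS FIELD AXIOM (Neukirch V (1.1), `i = 0`, PROVED in the tree:
`index_range_norm_eq_finrank_of_isCyclic`) for the cyclic extension `F_m/ℚ_v` of degree `2^m` of the local field `ℚ_v`.
[cite: NeukirchANT1999, Ch. V §1 Thm. (1.1)] -/
theorem index_range_norm_fixedField_layer (hκ : κ.IsCyclotomic) (v : HeightOneSpectrum (𝓞 ℚ))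
    (hv : ((2 : ℕ) : 𝓞 ℚ) ∈ v.asIdeal) (m : ℕ) :
    (Units.map (Algebra.norm (v.adicCompletion ℚ) :
        IntermediateField.fixedField (localSubgroup (κ.layerSubgroup m) (v.adicCompletion ℚ)) →*
          v.adicCompletion ℚ)).range.index = 2 ^ m := by
  haveI := finiteDimensional_fixedField_localSubgroup_layerSubgroup (κ := κ) v m
  haveI := isGalois_fixedField_localSubgroup_layerSubgroup (κ := κ) v m
  haveI := isCyclic_gal_fixedField_localSubgroup_layerSubgroup hκ v hv m
  rw [index_range_norm_eq_finrank_of_isCyclic (v.adicCompletion ℚ), finrank_fixedField_localSubgroup_layerSubgroup hκ v hv m]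

/-! ### The norm group of `F_m` -/

/-- **`N(F_mˣ) = ⟨2⟩ · ±(1 + 2^{m+2}ℤ₂)`** (`m ≥ 1`), read through a ring isomorphism `e : ℚ_v ≃ ℚ₂` (`p = 2`): a unit
`x` of `ℚ_v` is a norm from the `m`-th local layer `F_m` of the cyclotomic `ℤ₂`-tower iff `e x = 2^j · w` with `w ∈ ℤ₂ˣ`,
`w ≡ ±1 (mod 2^{m+2})`. The norm group CONTAINS `−1 = N(1 + y_m)`, `2 = N(2 + y_m)` (BRICK 13b) and every `2^m`-th
power (`= N` of a base element), hence (Hensel, BRICK 12) the subgroup `e⁻¹(T_m)`; both have index `2^m` (class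
field axiom; BRICK 12), so they are equal. [cite: NeukirchANT1999, Ch. V §1 Thm. (1.1)] -/
theorem mem_range_norm_fixedField_layer_iff (hκ : κ.IsCyclotomic) (v : HeightOneSpectrum (𝓞 ℚ))
    (hv : ((2 : ℕ) : 𝓞 ℚ) ∈ v.asIdeal) {m : ℕ} (hm : 1 ≤ m) (p : ℕ) [Fact p.Prime] (hp : p = 2)
    (e : v.adicCompletion ℚ ≃+* ℚ_[p]) (x : (v.adicCompletion ℚ)ˣ) :
    x ∈ (Units.map (Algebra.norm (v.adicCompletion ℚ) :
        IntermediateField.fixedField (localSubgroup (κ.layerSubgroup m) (v.adicCompletion ℚ)) →*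
          v.adicCompletion ℚ)).range ↔
      ∃ (j : ℤ) (w : ℤ_[p]ˣ), (toZModPow (m + 2) (w : ℤ_[p]) = 1 ∨ toZModPow (m + 2) (w : ℤ_[p]) = -1) ∧
        e (x : v.adicCompletion ℚ) = (p : ℚ_[p]) ^ j * ((w : ℤ_[p]) : ℚ_[p]) := by
  subst hp
  set F := IntermediateField.fixedField (localSubgroup (κ.layerSubgroup m) (v.adicCompletion ℚ)) with hF
  set S := (Units.map (Algebra.norm (v.adicCompletion ℚ) : F →* v.adicCompletion ℚ)).range with hS
  haveI := finiteDimensional_fixedField_localSubgroup_layerSubgroup (κ := κ) v m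
  haveI : CharZero (v.adicCompletion ℚ) :=
    charZero_of_injective_algebraMap (algebraMap ℚ (v.adicCompletion ℚ)).injective
  have hrank : Module.finrank (v.adicCompletion ℚ) F = 2 ^ m := finrank_fixedField_localSubgroup_layerSubgroup hκ v hv m
  -- the subgroup `T = e⁻¹ (⟨2⟩ · ±(1 + 2^{m+2}ℤ₂))` of `ℚ_vˣ`, index `2^m`
  obtain ⟨T₂, hT₂, hT₂idx⟩ := exists_subgroup_twoAdicLayerNorm m
  let eu : (v.adicCompletion ℚ)ˣ →* ℚ_[2]ˣ := Units.map (e : v.adicCompletion ℚ →* ℚ_[2])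
  have heu : Function.Surjective eu := fun u ↦
    ⟨Units.map (e.symm : ℚ_[2] →* v.adicCompletion ℚ) u, Units.ext (by simp [eu])⟩
  set T := T₂.comap eu with hT
  have hTidx : T.index = 2 ^ m := by rw [hT, Subgroup.index_comap_of_surjective _ heu, hT₂idx]
  have hmemT : ∀ y : (v.adicCompletion ℚ)ˣ, y ∈ T ↔ ∃ (j : ℤ) (w : ℤ_[2]ˣ),
      (toZModPow (m + 2) (w : ℤ_[2]) = 1 ∨ toZModPow (m + 2) (w : ℤ_[2]) = -1) ∧
        e (y : v.adicCompletion ℚ) = (2 : ℚ_[2]) ^ j * ((w : ℤ_[2]) : ℚ_[2]) := by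
    intro y
    rw [hT, Subgroup.mem_comap, hT₂]
    rfl
  -- elements of `S`: `-1`, `2`, and `2^m`-th powers
  obtain ⟨ζ, hζ⟩ : ∃ ζ : AlgebraicClosure (v.adicCompletion ℚ), IsPrimitiveRoot ζ (2 ^ (m + 2)) := by
    haveI : NeZero ((2 ^ (m + 2) : ℕ) : AlgebraicClosure (v.adicCompletion ℚ)) :=
      ⟨by rw [Nat.cast_pow]; exact pow_ne_zero _ (by norm_num)⟩
    exact HasEnoughRootsOfUnity.exists_primitiveRoot (AlgebraicClosure (v.adicCompletion ℚ)) (2 ^ (m + 2))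
  obtain ⟨hn1, hn2⟩ := norm_one_add_eq_and_norm_two_add_eq hκ v hv hm hζ
  set y : F := ⟨ζ + ζ⁻¹, add_inv_mem_fixedField_localSubgroup_layerSubgroup hκ v m hζ.pow_eq_one⟩ with hy
  have hmemS : ∀ z : (v.adicCompletion ℚ)ˣ, z ∈ S ↔
      ∃ f : F, Algebra.norm (v.adicCompletion ℚ) f = (z : v.adicCompletion ℚ) := by
    intro z
    rw [hS, MonoidHom.mem_range]
    constructor
    · rintro ⟨f, hf⟩
      exact ⟨(f : F), by simp [← hf]⟩
    · rintro ⟨f, hf⟩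
      have hf0 : f ≠ 0 := by
        rintro rfl
        rw [Algebra.norm_zero] at hf
        exact z.ne_zero hf.symm
      exact ⟨Units.mk0 f hf0, Units.ext (by simp [hf])⟩
  have hneg1 : -1 ∈ S := (hmemS _).mpr ⟨1 + y, by rw [hn1, Units.val_neg, Units.val_one]⟩
  have h2u : (2 : v.adicCompletion ℚ) ≠ 0 := by norm_num
  have htwo : Units.mk0 (2 : v.adicCompletion ℚ) h2u ∈ S := (hmemS _).mpr ⟨2 + y, by rw [hn2, Units.val_mk0]⟩
  have hpow : ∀ z : (v.adicCompletion ℚ)ˣ, z ^ 2 ^ m ∈ S := fun z ↦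
    (hmemS _).mpr ⟨algebraMap (v.adicCompletion ℚ) F z, by
      rw [Algebra.norm_algebraMap, hrank, Units.val_pow_eq_pow_val]⟩
  -- `T ≤ S`
  have hTS : T ≤ S := by
    intro z hz
    obtain ⟨j, w, hw, hz⟩ := (hmemT z).mp hz
    -- `±w = w₀ ^ 2^m`
    obtain ⟨s, w₀, hs, hw₀⟩ : ∃ (s : (v.adicCompletion ℚ)ˣ) (w₀ : ℤ_[2]ˣ), (s = 1 ∨ s = -1) ∧
        ((w : ℤ_[2]) : ℚ_[2]) = e (s : v.adicCompletion ℚ) * (((w₀ ^ 2 ^ m : ℤ_[2]ˣ) : ℤ_[2]) : ℚ_[2]) := by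
      rcases hw with h | h
      · obtain ⟨w₀, hw₀⟩ := exists_units_pow_two_pow_eq_of_toZModPow_eq_one m h
        exact ⟨1, w₀, Or.inl rfl, by rw [hw₀, Units.val_one, map_one, one_mul]⟩
      · have h' : toZModPow (m + 2) (((-w : ℤ_[2]ˣ) : ℤ_[2])) = 1 := by
          rw [Units.val_neg, map_neg, h, neg_neg]
        obtain ⟨w₀, hw₀⟩ := exists_units_pow_two_pow_eq_of_toZModPow_eq_one m h'
        refine ⟨-1, w₀, Or.inr rfl, ?_⟩
        rw [hw₀, Units.val_neg, Units.val_one, map_neg, map_one, Units.val_neg, PadicInt.coe_neg, neg_one_mul,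
          neg_neg]
    -- `z = s · 2^j · (e⁻¹ w₀) ^ 2^m`
    have hw₀1 : ‖((w₀ : ℤ_[2]) : ℚ_[2])‖ = 1 := PadicInt.norm_units w₀
    have hw₀ne : e.symm ((w₀ : ℤ_[2]) : ℚ_[2]) ≠ 0 := by
      rw [ne_eq, map_eq_zero_iff _ e.symm.injective]
      exact norm_pos_iff.mp (by rw [hw₀1]; norm_num)
    let b : (v.adicCompletion ℚ)ˣ := Units.mk0 (e.symm ((w₀ : ℤ_[2]) : ℚ_[2])) hw₀ne
    have hzprod : z = s * (Units.mk0 (2 : v.adicCompletion ℚ) h2u) ^ j * b ^ 2 ^ m := by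
      apply Units.ext
      apply e.injective
      rw [hz, hw₀]
      simp only [Units.val_mul, map_mul, Units.val_zpow_eq_zpow_val, map_zpow₀, Units.val_mk0, map_ofNat,
        Units.val_pow_eq_pow_val, map_pow, RingEquiv.apply_symm_apply, b]
      push_cast
      ring
    rw [hzprod]
    refine S.mul_mem (S.mul_mem ?_ (S.zpow_mem htwo j)) (hpow b)
    rcases hs with rfl | rfl
    · exact S.one_mem
    · exact hneg1
  -- equal indices `2^m`
  have hSidx : S.index = 2 ^ m := index_range_norm_fixedField_layer hκ v hv m
  have hTS' : T = S := subgroup_eq_of_le_of_index_eq hTS (hTidx.trans hSidx.symm) (by rw [hSidx]; positivity)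
  rw [← hTS', hmemT]
  simp only [Nat.cast_ofNat]

/-- **The tower non-norm lemma at level `0`**: for `v ∋ 2`, a ring isomorphism `e : ℚ_v ≃ ℚ₂`, `q ∈ ℚ_v` with
`e q = 2^k · u`, `u ∈ ℤ₂`, `u ≡ 3, 5 (mod 8)` (the Tate parameter and Tate unit of the binder, BRICK 3
`exists_padicInt_tateUnit_of_tateJ_eq`), `a` odd and `m ≥ 1`: **no element of the local layer `F_m` has norm
`q^{2^{m−1} a}`** — its unit part `u^{2^{m−1}a} ≡ ±(1 + 2^{m+1}) (mod 2^{m+2})` is not `≡ ±1` (BRICK 12), while norms from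
`F_m` have unit part `≡ ±1 (mod 2^{m+2})`. This replaces the memo's norm-residue computation `(q, ℚ_{2,m}/ℚ₂) ≠ 1`.
[cite: NeukirchANT1999, Ch. V §1 Thm. (1.1)] -/
theorem norm_ne_pow_of_tateUnit (hκ : κ.IsCyclotomic) (v : HeightOneSpectrum (𝓞 ℚ))
    (hv : ((2 : ℕ) : 𝓞 ℚ) ∈ v.asIdeal) {m : ℕ} (hm : 1 ≤ m) (p : ℕ) [Fact p.Prime] (hp : p = 2)
    (e : v.adicCompletion ℚ ≃+* ℚ_[p]) {q : v.adicCompletion ℚ} {k : ℕ} {u : ℤ_[p]}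
    (hq : e q = (p : ℚ_[p]) ^ k * (u : ℚ_[p])) (hu : toZModPow 3 u = 3 ∨ toZModPow 3 u = 5) {a : ℕ} (ha : Odd a)
    (f : IntermediateField.fixedField (localSubgroup (κ.layerSubgroup m) (v.adicCompletion ℚ))) :
    Algebra.norm (v.adicCompletion ℚ) f ≠ q ^ (2 ^ (m - 1) * a) := by
  subst hp
  intro hf
  obtain ⟨m', rfl⟩ : ∃ m', m = m' + 1 := ⟨m - 1, by omega⟩
  simp only [Nat.add_sub_cancel] at hf
  -- `u` is a unit of `ℤ₂`
  have huu : IsUnit u := by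
    rw [PadicInt.isUnit_iff]
    by_contra hne
    have hlt : ‖u‖ < 1 := lt_of_le_of_ne (PadicInt.norm_le_one u) hne
    rw [PadicInt.norm_lt_one_iff_dvd] at hlt
    obtain ⟨c, rfl⟩ := hlt
    have h8 : toZModPow 3 ((2 : ℤ_[2]) * c) = 2 * toZModPow 3 c := by rw [map_mul, map_ofNat]
    have key : ∀ t : ZMod (2 ^ 3), 2 * t ≠ 3 ∧ 2 * t ≠ 5 := by decide
    rcases hu with h | h
    · exact (key _).1 (h8 ▸ h)
    · exact (key _).2 (h8 ▸ h)
  set U : ℤ_[2]ˣ := huu.unit with hU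
  have hUval : (U : ℤ_[2]) = u := huu.unit_spec
  -- `q ≠ 0` and the norm is a unit of `ℚ_v`
  have hq' : e q = (2 : ℚ_[2]) ^ k * (u : ℚ_[2]) := by simpa using hq
  have hq0 : q ≠ 0 := by
    intro h0
    rw [h0, map_zero, eq_comm, mul_eq_zero] at hq'
    rcases hq' with h | h
    · exact absurd h (pow_ne_zero _ (by norm_num))
    · rw [← hUval] at h
      exact U.ne_zero (PadicInt.coe_eq_zero.mp h)
  haveI := finiteDimensional_fixedField_localSubgroup_layerSubgroup (κ := κ) v (m' + 1)
  have hmem : Units.mk0 (q ^ (2 ^ m' * a)) (pow_ne_zero _ hq0) ∈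
      (Units.map (Algebra.norm (v.adicCompletion ℚ) :
        IntermediateField.fixedField (localSubgroup (κ.layerSubgroup (m' + 1)) (v.adicCompletion ℚ)) →*
          v.adicCompletion ℚ)).range := by
    have hf0 : f ≠ 0 := by
      rintro rfl
      rw [Algebra.norm_zero] at hf
      exact pow_ne_zero _ hq0 hf.symm
    exact ⟨Units.mk0 f hf0, Units.ext (by simp [hf])⟩
  rw [mem_range_norm_fixedField_layer_iff hκ v hv (by omega) 2 rfl e] at hmem
  obtain ⟨j, w, hw, hjw⟩ := hmem
  have hlhs : e (q ^ (2 ^ m' * a)) = (2 : ℚ_[2]) ^ (((k * (2 ^ m' * a) : ℕ)) : ℤ) *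
      (((U ^ (2 ^ m' * a) : ℤ_[2]ˣ) : ℤ_[2]) : ℚ_[2]) := by
    rw [map_pow, hq', mul_pow, ← pow_mul, zpow_natCast, Units.val_pow_eq_pow_val, hUval, PadicInt.coe_pow]
  rw [Units.val_mk0, hlhs] at hjw
  have hjw' : (2 : ℚ_[2]) ^ (((k * (2 ^ m' * a) : ℕ)) : ℤ) * (((U ^ (2 ^ m' * a) : ℤ_[2]ˣ) : ℤ_[2]) : ℚ_[2]) =
      (2 : ℚ_[2]) ^ j * ((w : ℤ_[2]) : ℚ_[2]) := by simpa using hjw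
  obtain ⟨-, hwU⟩ := two_zpow_mul_units_inj hjw'
  -- `w = U ^ (2^m' a)` has residue `±(1 + 2^{m'+2}) ≠ ±1`
  obtain ⟨h1, h2⟩ := toZModPow_pow_ne_one_and_ne_neg_one_of_tateUnit hu ha m'
  rw [← hUval, ← Units.val_pow_eq_pow_val, hwU] at h1 h2
  rcases hw with h | h
  · exact h1 h
  · exact h2 h

end Literature.NumberTheory.EllipticCurves.Greenberg1999.MultTowerNS2

end Part6

/-!
## Part 7 — port of `Summits/BirchSwinnertonDyer/BirchSwinnertonDyer/Theorems/ByReductionTypeAtTwoMultTowerNS2TowerCosets.lean`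

# Route `ByReductionTypeAtTwo`, crux `MultUpperHalfAtTwo` (item stmt-BirchSwinnertonDyer-19922), TOWER road, the
# «ONE BIT AT A NON-SPLIT 2» rows: KERNEL BRICK 15 — cosets of the local layer subgroups by a topological generator,
# finite levels, «orbit product = norm», and the RELATIVE tower non-norm lemma `q^{2^{R−1}a} ∉ N(F_{n+R}/F_n)`

HONEST FRAMING (cell `bsd-2adic`, run/shared/lean/pub/bsd-2adic/, seat `bsd-2adic-tower-1` GEN 9, HUMAN RULINGS
D-0036 / D-0054 / D-0074): TOOL theorems only (no definition, no named fact, no `sorry`); closes nothing by itself;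
nothing booked; BSD is not proved by any of this. Modules M5/M6 of the KERNELISATION of the MEMO binder
`MultTowerNS2.localTowerKerTwoTorsion_le_two_nonsplitTwo_of_tateUnit` (scope memo HOME/tower/SCOPE-hNS2one-kernel-GEN8.md).
Setting: `κ` the cyclotomic `ℤ₂`-extension, `v ∋ 2`, `K = ℚ_v`, `Γ = Gal(K̄_v/K)`, `H_m = localSubgroup (κ.layerSubgroup m) K`,
`H_∞ = localSubgroup κ.kerSubgroup K`, `F_m = K̄_v^{H_m}`, and `g ∈ H_n` generating `H_n` topologically together with
`H_∞` (the binder shape of BRICK 11 `finite_torsionBy_localTowerKerPrimary_and_card_le`).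

* `exists_units_kappa_resGal_eq_of_generate` — `κ(res g) = 2^n·u` with `u ∈ ℤ₂ˣ`;
* `exists_pow_inv_mul_mem_localSubgroup_layerSubgroup` — **cosets**: every `h ∈ H_n` is `g^i h'` with `i < 2^R`,
  `h' ∈ H_{n+R}`; `pow_mem_localSubgroup_layerSubgroup_iff` — `g^i ∈ H_{n+R} ↔ 2^R ∣ i`;
* `exists_forall_mem_localSubgroup_layerSubgroup_smul_eq` — **finite level**: an element of `K̄_v` fixed by `H_∞ ∩ S`
  (`S` closed) is fixed by `H_m ∩ S` for some `m` (compactness of `Γ`);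
* `algebraMap_norm_eq_prod_smul` — **orbit product = norm**: for an open subgroup `H` with `fixingSubgroup (K̄^H) = H`
  normal and coset representatives `γ : ι → Γ` of `Γ/H` (`#ι = [K̄^H : K]`), `N_{K̄^H/K}(f) = ∏ γ_k f`;
* `prod_smul_ne_pow_of_tateUnit` — **`∏_{i<2^R} g^i f ≠ q^{2^{R−1}a}` for `f ∈ F_{n+R}`, `a` odd, `R ≥ 1`** (BRICK 14
  at level `n + R` with the representatives `g₀^j g^i` of `Γ/H_{n+R}`, `κ(res g₀) = 1`): the relative tower non-norm
  lemma of scope S5 in orbit-product form, as consumed by S4.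

References: L. Washington, *Introduction to Cyclotomic Fields*, §13.1; J. Neukirch, *ANT* IV §1, V (1.1); scope memo S5.
-/

section Part7

set_option autoImplicit false

open scoped _root_.Classical _root_.IntermediateField

namespace Literature.NumberTheory.EllipticCurves.Greenberg1999.MultTowerNS2

open _root_.NumberField _root_.IsDedekindDomain _root_.Field _root_.PadicInt _root_.Literature.NumberTheory.EllipticCurves
  _root_.Literature.NumberTheory.GaloisRepresentations

variable {κ : ZpExtension ℚ 2}

/-! ### `κ(res g)` for a topological generator, and the cosets of `H_{n+R}` in `H_n` -/

/-- **`κ(res g) = 2^n · u`, `u` a unit**, for `g ∈ H_n` generating `H_n` topologically together with `H_∞` (otherwise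
`g ∈ H_{n+1}`, an open subgroup containing `H_∞`, and `H_n ≤ H_{n+1}` contradicts `[H_n : H_{n+1}] = 2`, BRICK 8).
[cite: Washington1997, §13.1] -/
theorem exists_units_kappa_resGal_eq_of_generate (hκ : κ.IsCyclotomic) (v : HeightOneSpectrum (𝓞 ℚ))
    (hv : ((2 : ℕ) : 𝓞 ℚ) ∈ v.asIdeal) (n : ℕ) {g : absoluteGaloisGroup (v.adicCompletion ℚ)}
    (hg : g ∈ localSubgroup (κ.layerSubgroup n) (v.adicCompletion ℚ))
    (hgen : ∀ U : Subgroup (absoluteGaloisGroup (v.adicCompletion ℚ)),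
      IsOpen (U : Set (absoluteGaloisGroup (v.adicCompletion ℚ))) →
        localSubgroup κ.kerSubgroup (v.adicCompletion ℚ) ≤ U → g ∈ U →
          localSubgroup (κ.layerSubgroup n) (v.adicCompletion ℚ) ≤ U) :
    ∃ u : ℤ_[2]ˣ, ((κ (resGal (K := ℚ) (v.adicCompletion ℚ) g)).toAdd : ℤ_[2]) = 2 ^ n * (u : ℤ_[2]) := by
  rw [mem_localSubgroup_iff, ZpExtension.mem_layerSubgroup] at hg
  obtain ⟨b, hb⟩ := hg
  by_cases hbu : IsUnit b
  · exact ⟨hbu.unit, by rw [IsUnit.unit_spec]; exact_mod_cast hb⟩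
  exfalso
  -- `2 ∣ b`, so `g ∈ H_{n+1}`
  have hb1 : ‖b‖ < 1 := lt_of_le_of_ne (PadicInt.norm_le_one b) (fun h ↦ hbu (PadicInt.isUnit_iff.mpr h))
  rw [PadicInt.norm_lt_one_iff_dvd] at hb1
  obtain ⟨c, rfl⟩ := hb1
  have hg1 : g ∈ localSubgroup (κ.layerSubgroup (n + 1)) (v.adicCompletion ℚ) := by
    rw [mem_localSubgroup_iff, ZpExtension.mem_layerSubgroup]
    refine ⟨c, ?_⟩
    have h : ((κ (resGal (K := ℚ) (v.adicCompletion ℚ) g)).toAdd : ℤ_[2]) = (2 : ℤ_[2]) ^ n * (2 * c) := by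
      exact_mod_cast hb
    rw [h]; push_cast; ring
  have hle := hgen _ (isOpen_localSubgroup _ (κ.isOpen_layerSubgroup (n + 1)) _)
    (fun τ hτ ↦ by
      rw [mem_localSubgroup_iff] at hτ ⊢
      exact κ.kerSubgroup_le_layerSubgroup (n + 1) hτ) hg1
  have hidx := relIndex_localSubgroup_layerSubgroup_succ hκ v hv n
  rw [Subgroup.relIndex_eq_one.mpr hle] at hidx
  exact absurd hidx (by norm_num)

/-- **The cosets of `H_{n+R}` in `H_n` are `g^i H_{n+R}`, `i < 2^R`**: for `g` with `κ(res g) = 2^n u` (`u` a unit) and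
`h ∈ H_n` there is `i < 2^R` with `(g^i)⁻¹ h ∈ H_{n+R}` (`κ(res h) = 2^n c`, `i ≡ c u⁻¹ (mod 2^R)`).
[cite: Washington1997, §13.1] -/
theorem exists_pow_inv_mul_mem_localSubgroup_layerSubgroup (v : HeightOneSpectrum (𝓞 ℚ)) (n R : ℕ)
    {g : absoluteGaloisGroup (v.adicCompletion ℚ)} {u : ℤ_[2]ˣ}
    (hu : ((κ (resGal (K := ℚ) (v.adicCompletion ℚ) g)).toAdd : ℤ_[2]) = 2 ^ n * (u : ℤ_[2]))
    {h : absoluteGaloisGroup (v.adicCompletion ℚ)} (hh : h ∈ localSubgroup (κ.layerSubgroup n) (v.adicCompletion ℚ)) :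
    ∃ i : ℕ, i < 2 ^ R ∧ (g ^ i)⁻¹ * h ∈ localSubgroup (κ.layerSubgroup (n + R)) (v.adicCompletion ℚ) := by
  rw [mem_localSubgroup_iff, ZpExtension.mem_layerSubgroup] at hh
  obtain ⟨c, hc⟩ := hh
  set i : ℕ := (toZModPow R (c * ((u⁻¹ : ℤ_[2]ˣ) : ℤ_[2]))).val with hi
  refine ⟨i, ZMod.val_lt _, ?_⟩
  rw [mem_localSubgroup_iff, ZpExtension.mem_layerSubgroup]
  simp only [map_mul, map_inv, map_pow, toAdd_mul, toAdd_inv, toAdd_pow, hu]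
  have hc' : ((κ (resGal (K := ℚ) (v.adicCompletion ℚ) h)).toAdd : ℤ_[2]) = (2 : ℤ_[2]) ^ n * c := by exact_mod_cast hc
  rw [hc']
  -- `c u⁻¹ - i ∈ 2^R ℤ₂`
  have hker : c * ((u⁻¹ : ℤ_[2]ˣ) : ℤ_[2]) - (i : ℤ_[2]) ∈ RingHom.ker (toZModPow (p := 2) R) := by
    rw [RingHom.mem_ker, map_sub, map_natCast, hi, ZMod.natCast_zmod_val, sub_self]
  rw [ker_toZModPow, Ideal.mem_span_singleton] at hker
  obtain ⟨d, hd⟩ := hker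
  refine ⟨(u : ℤ_[2]) * d, ?_⟩
  have hud : c - (i : ℤ_[2]) * (u : ℤ_[2]) = (u : ℤ_[2]) * ((2 : ℤ_[2]) ^ R * d) := by
    have h1 : (u : ℤ_[2]) * (c * ((u⁻¹ : ℤ_[2]ˣ) : ℤ_[2]) - (i : ℤ_[2])) = c - (i : ℤ_[2]) * (u : ℤ_[2]) := by
      rw [mul_sub, ← mul_assoc, mul_comm (u : ℤ_[2]) c, mul_assoc, Units.mul_inv, mul_one, mul_comm]
    rw [← h1, hd]; push_cast; ring
  rw [nsmul_eq_mul]; push_cast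
  linear_combination (2 : ℤ_[2]) ^ n * hud

/-- **`g^i ∈ H_{n+R} ↔ 2^R ∣ i`** for `g` with `κ(res g) = 2^n u`, `u` a unit. [cite: Washington1997, §13.1] -/
theorem pow_mem_localSubgroup_layerSubgroup_iff (v : HeightOneSpectrum (𝓞 ℚ)) (n R : ℕ)
    {g : absoluteGaloisGroup (v.adicCompletion ℚ)} {u : ℤ_[2]ˣ}
    (hu : ((κ (resGal (K := ℚ) (v.adicCompletion ℚ) g)).toAdd : ℤ_[2]) = 2 ^ n * (u : ℤ_[2])) (i : ℕ) :
    g ^ i ∈ localSubgroup (κ.layerSubgroup (n + R)) (v.adicCompletion ℚ) ↔ 2 ^ R ∣ i := by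
  rw [mem_localSubgroup_iff, ZpExtension.mem_layerSubgroup]
  simp only [map_pow, toAdd_pow, hu, nsmul_eq_mul, pow_add]
  have h2n : (2 : ℤ_[2]) ^ n ≠ 0 := pow_ne_zero _ two_ne_zero
  rw [show (i : ℤ_[2]) * ((2 : ℤ_[2]) ^ n * (u : ℤ_[2])) = (2 : ℤ_[2]) ^ n * ((i : ℤ_[2]) * u) by ring]
  push_cast
  rw [mul_dvd_mul_iff_left h2n, Units.dvd_mul_right,
    show ((i : ℤ_[2])) = ((i : ℤ) : ℤ_[2]) by push_cast; rfl,
    show ((2 : ℤ_[2]) ^ R) = ((2 : ℕ) : ℤ_[2]) ^ R by norm_num, PadicInt.pow_p_dvd_int_iff]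
  exact_mod_cast Iff.rfl

/-! ### Finite levels -/

/-- `⋂_m H_m = H_∞`: an element of `Γ_{ℚ_v}` lying in every local layer subgroup lies in the local kernel subgroup
(`κ(res σ)` is divisible by every `2^m`, hence `0`). [cite: Washington1997, §13.1] -/
theorem mem_localSubgroup_kerSubgroup_of_forall (v : HeightOneSpectrum (𝓞 ℚ)) {σ : absoluteGaloisGroup (v.adicCompletion ℚ)}
    (hσ : ∀ m, σ ∈ localSubgroup (κ.layerSubgroup m) (v.adicCompletion ℚ)) :
    σ ∈ localSubgroup κ.kerSubgroup (v.adicCompletion ℚ) := by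
  rw [mem_localSubgroup_iff, ZpExtension.mem_kerSubgroup]
  apply Multiplicative.toAdd.injective
  rw [toAdd_one]
  by_contra hne
  set x : ℤ_[2] := (κ (resGal (K := ℚ) (v.adicCompletion ℚ) σ)).toAdd with hx
  obtain ⟨m, hm⟩ : ∃ m : ℕ, (2 : ℝ) ^ (-(m : ℤ)) < ‖x‖ := by
    have hpos : 0 < ‖x‖ := norm_pos_iff.mpr hne
    obtain ⟨m, hm⟩ := exists_pow_lt_of_lt_one hpos (by norm_num : (1 / 2 : ℝ) < 1)
    refine ⟨m, ?_⟩
    rw [zpow_neg, zpow_natCast, ← inv_pow, show (2 : ℝ)⁻¹ = 1 / 2 by norm_num]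
    exact hm
  have h := hσ m
  rw [mem_localSubgroup_iff, ZpExtension.mem_layerSubgroup, ← Ideal.mem_span_singleton, ← hx,
    ← PadicInt.norm_le_pow_iff_mem_span_pow] at h
  have h' : ‖x‖ ≤ (2 : ℝ) ^ (-(m : ℤ)) := by exact_mod_cast h
  exact absurd (lt_of_lt_of_le hm h') (lt_irrefl _)

/-- **Finite level**: if `x ∈ K̄_v` is fixed by every element of `H_∞ ∩ S` (`S ≤ Γ` closed), then for some `m` it is
fixed by every element of `H_m ∩ S` — the sets `(H_m ∩ S) ∖ Fix(x)` are compact, decreasing, with empty intersection.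
[cite: NeukirchANT1999, Ch. IV §1] -/
theorem exists_forall_mem_localSubgroup_layerSubgroup_smul_eq (v : HeightOneSpectrum (𝓞 ℚ))
    (S : Subgroup (absoluteGaloisGroup (v.adicCompletion ℚ)))
    (hS : IsClosed (S : Set (absoluteGaloisGroup (v.adicCompletion ℚ)))) (x : AlgebraicClosure (v.adicCompletion ℚ))
    (hx : ∀ h ∈ localSubgroup κ.kerSubgroup (v.adicCompletion ℚ), h ∈ S → h • x = x) :
    ∃ m : ℕ, ∀ h ∈ localSubgroup (κ.layerSubgroup m) (v.adicCompletion ℚ), h ∈ S → h • x = x := by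
  -- the open subgroup `U = Gal(K̄/K(x))` of elements fixing `x`
  let H : ℕ → Subgroup (absoluteGaloisGroup (v.adicCompletion ℚ)) :=
    fun m ↦ localSubgroup (κ.layerSubgroup m) (v.adicCompletion ℚ)
  have hHanti : ∀ m, H (m + 1) ≤ H m := fun m ↦ localSubgroup_layerSubgroup_succ_le (κ := κ) v m
  have hHopen : ∀ m, IsOpen (H m : Set (absoluteGaloisGroup (v.adicCompletion ℚ))) :=
    fun m ↦ isOpen_localSubgroup _ (κ.isOpen_layerSubgroup m) _
  have hHker : ∀ σ : absoluteGaloisGroup (v.adicCompletion ℚ), (∀ m, σ ∈ H m) →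
      σ ∈ localSubgroup κ.kerSubgroup (v.adicCompletion ℚ) := fun σ h ↦ mem_localSubgroup_kerSubgroup_of_forall v h
  have hint : IsIntegral (v.adicCompletion ℚ) x := Algebra.IsIntegral.isIntegral x
  haveI : FiniteDimensional (v.adicCompletion ℚ) (v.adicCompletion ℚ)⟮x⟯ := IntermediateField.adjoin.finiteDimensional hint
  let U : Subgroup (absoluteGaloisGroup (v.adicCompletion ℚ)) := ((v.adicCompletion ℚ)⟮x⟯).fixingSubgroup
  have hUopen : IsOpen (U : Set (absoluteGaloisGroup (v.adicCompletion ℚ))) :=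
    IntermediateField.fixingSubgroup_isOpen _
  have hUfix : ∀ σ ∈ U, σ • x = x := fun σ hσ ↦
    (IntermediateField.mem_fixingSubgroup_iff _ _).mp hσ x (IntermediateField.mem_adjoin_simple_self _ x)
  have hfixU : ∀ σ : absoluteGaloisGroup (v.adicCompletion ℚ), σ • x = x → σ ∈ U := by
    intro σ hσ
    have hle : (v.adicCompletion ℚ)⟮x⟯ ≤ IntermediateField.fixedField (Subgroup.zpowers σ) := by
      rw [IntermediateField.adjoin_simple_le_iff, IntermediateField.mem_fixedField_iff]
      rintro τ ⟨k, rfl⟩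
      exact MulAction.mem_stabilizer_iff.mp
        ((MulAction.stabilizer (absoluteGaloisGroup (v.adicCompletion ℚ)) x).zpow_mem
          (MulAction.mem_stabilizer_iff.mpr hσ) k)
    exact (IntermediateField.mem_fixingSubgroup_iff _ _).mpr fun y hy ↦
      (IntermediateField.mem_fixedField_iff _ _).mp (hle hy) σ (Subgroup.mem_zpowers σ)
  -- the compact sets `(H m ∩ S) \ U`
  by_contra hcon
  have hcon' : ∀ m, ∃ h, h ∈ H m ∧ h ∈ S ∧ h • x ≠ x := by
    intro m
    by_contra hm
    refine hcon ⟨m, fun h hh hhS ↦ ?_⟩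
    by_contra hne
    exact hm ⟨h, hh, hhS, hne⟩
  let t : ℕ → Set (absoluteGaloisGroup (v.adicCompletion ℚ)) := fun m ↦ ((H m : Set _) ∩ (S : Set _)) \ (U : Set _)
  have htd : ∀ m, t (m + 1) ⊆ t m := fun m σ hσ ↦ ⟨⟨hHanti m hσ.1.1, hσ.1.2⟩, hσ.2⟩
  have htn : ∀ m, (t m).Nonempty := by
    intro m
    obtain ⟨h, hh, hhS, hne⟩ := hcon' m
    exact ⟨h, ⟨hh, hhS⟩, fun hU ↦ hne (hUfix h hU)⟩
  have htcl : ∀ m, IsClosed (t m) := fun m ↦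
    (((H m).isClosed_of_isOpen (hHopen m)).inter hS).sdiff hUopen
  -- (`CharZero ℚ_v` enters the context only now, for the compactness of `Γ`; see BRICK 14 for why)
  haveI : CharZero (v.adicCompletion ℚ) :=
    charZero_of_injective_algebraMap (algebraMap ℚ (v.adicCompletion ℚ)).injective
  obtain ⟨σ, hσ⟩ := IsCompact.nonempty_iInter_of_sequence_nonempty_isCompact_isClosed t htd htn
    (htcl 0).isCompact htcl
  rw [Set.mem_iInter] at hσ
  have hσS : σ ∈ S := (hσ 0).1.2
  have hσU : σ ∉ U := (hσ 0).2
  have hσi := hHker σ fun m ↦ (hσ m).1.1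
  exact hσU (hfixU σ (hx σ hσi hσS))

/-! ### Orbit product = norm -/

/-- **Orbit product = norm.** Let `E ⊆ K̄` be a finite Galois subextension of `K = ℚ_v` whose fixing subgroup is `H`,
and `γ : ι → Γ` representatives of ALL cosets of `H` in `Γ = Gal(K̄/K)` with `#ι = [E : K]`. Then for `f ∈ E`:
`N_{E/K}(f) = ∏_k γ_k(f)` in `K̄` (Mathlib `Algebra.norm_eq_prod_automorphisms` and `Gal(E/K) ≅ Γ/H`).
[cite: NeukirchANT1999, Ch. IV §1] -/
theorem algebraMap_norm_eq_prod_smul (v : HeightOneSpectrum (𝓞 ℚ))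
    (E : IntermediateField (v.adicCompletion ℚ) (AlgebraicClosure (v.adicCompletion ℚ)))
    [FiniteDimensional (v.adicCompletion ℚ) E] [IsGalois (v.adicCompletion ℚ) E]
    {H : Subgroup (absoluteGaloisGroup (v.adicCompletion ℚ))}
    (hH : ∀ σ : absoluteGaloisGroup (v.adicCompletion ℚ), σ ∈ E.fixingSubgroup ↔ σ ∈ H)
    {ι : Type*} [Fintype ι] (γ : ι → absoluteGaloisGroup (v.adicCompletion ℚ))
    (hcov : ∀ σ : absoluteGaloisGroup (v.adicCompletion ℚ), ∃ k, σ⁻¹ * γ k ∈ H)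
    (hcard : Fintype.card ι = Module.finrank (v.adicCompletion ℚ) E) (f : E) :
    algebraMap (v.adicCompletion ℚ) (AlgebraicClosure (v.adicCompletion ℚ)) (Algebra.norm (v.adicCompletion ℚ) f) =
      ∏ k, γ k • (f : AlgebraicClosure (v.adicCompletion ℚ)) := by
  have hprod := Algebra.norm_eq_prod_automorphisms (v.adicCompletion ℚ) (L := E) f
  have h1 : algebraMap (v.adicCompletion ℚ) (AlgebraicClosure (v.adicCompletion ℚ)) (Algebra.norm (v.adicCompletion ℚ) f) =
      ((algebraMap (v.adicCompletion ℚ) E (Algebra.norm (v.adicCompletion ℚ) f) : E) :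
        AlgebraicClosure (v.adicCompletion ℚ)) := by
    rw [IsScalarTower.algebraMap_apply (v.adicCompletion ℚ) E (AlgebraicClosure (v.adicCompletion ℚ))]
    rfl
  rw [h1, hprod, IntermediateField.coe_prod]
  -- the bijection `ι → Gal(E/K)`, `k ↦ restriction of γ k`
  let Θ : ι → (E ≃ₐ[v.adicCompletion ℚ] E) := fun k ↦ AlgEquiv.restrictNormalHom E (γ k)
  have hker : ∀ σ : absoluteGaloisGroup (v.adicCompletion ℚ), AlgEquiv.restrictNormalHom E σ = 1 ↔ σ ∈ H :=
    fun σ ↦ (MonoidHom.mem_ker (f := AlgEquiv.restrictNormalHom E)).symm.trans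
      ((SetLike.ext_iff.mp (IntermediateField.restrictNormalHom_ker E) σ).trans (hH σ))
  have hsurj : Function.Surjective Θ := by
    intro τ
    obtain ⟨σ, hσ⟩ := AlgEquiv.restrictNormalHom_surjective (AlgebraicClosure (v.adicCompletion ℚ)) τ
    let σ' : absoluteGaloisGroup (v.adicCompletion ℚ) := σ
    obtain ⟨k, hk⟩ := hcov σ'
    refine ⟨k, ?_⟩
    have h1 : AlgEquiv.restrictNormalHom E (σ'⁻¹ * γ k) = 1 := (hker _).mpr hk
    have hm : AlgEquiv.restrictNormalHom E σ'⁻¹ * AlgEquiv.restrictNormalHom E (γ k) = 1 :=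
      (map_mul (AlgEquiv.restrictNormalHom E) σ'⁻¹ (γ k)).symm.trans h1
    have hi : (AlgEquiv.restrictNormalHom E σ')⁻¹ * AlgEquiv.restrictNormalHom E (γ k) = 1 :=
      (congrArg (· * AlgEquiv.restrictNormalHom E (γ k)) (map_inv (AlgEquiv.restrictNormalHom E) σ')).symm.trans hm
    have h2 : AlgEquiv.restrictNormalHom E σ' = AlgEquiv.restrictNormalHom E (γ k) := inv_mul_eq_one.mp hi
    exact h2.symm.trans hσ
  have hbij : Function.Bijective Θ := by
    rw [Fintype.bijective_iff_surjective_and_card]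
    refine ⟨hsurj, ?_⟩
    rw [hcard, ← IsGalois.card_aut_eq_finrank, Nat.card_eq_fintype_card]
  rw [← hbij.prod_comp]
  refine Finset.prod_congr rfl fun k _ ↦ ?_
  change ((AlgEquiv.restrictNormalHom E (γ k) f : E) : AlgebraicClosure (v.adicCompletion ℚ)) = _
  rw [AlgEquiv.restrictNormalHom_apply]
  rfl

/-! ### The relative tower non-norm lemma in orbit-product form -/

/-- **`∏_{i<2^R} g^i(f) ≠ q^{2^{R−1}a}` for `f ∈ F_{n+R}`, `a` odd, `R ≥ 1`.** Here `κ` is the cyclotomic `ℤ₂`-extension,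
`v ∋ 2`, `g ∈ Γ_{ℚ_v}` with `κ(res g) = 2^n u_g` (a topological generator of `H_n` modulo `H_∞`), `e : ℚ_v ≃ ℚ₂` a ring
isomorphism and `q ∈ ℚ_v` with `e q = 2^k u`, `u ≡ 3, 5 (mod 8)` (the Tate parameter). With `g₀`, `κ(res g₀) = 1`, the
elements `g₀^j g^i` (`j < 2^n`, `i < 2^R`) represent `Γ/H_{n+R}`, so `N_{F_{n+R}/ℚ_v}(f) = ∏_j g₀^j(∏_i g^i f)`; if the
inner product were `q^{2^{R−1}a} ∈ ℚ_v` the norm would be `q^{2^{n+R−1}a}`, contradicting BRICK 14 `norm_ne_pow_of_tateUnit`.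
This is `q^{2^{R−1}a} ∉ N(F_{n+R}/F_n)` (scope memo S5) in the form consumed by S4. [cite: NeukirchANT1999, Ch. V §1 Thm. (1.1)] -/
theorem prod_smul_ne_pow_of_tateUnit (hκ : κ.IsCyclotomic) (v : HeightOneSpectrum (𝓞 ℚ))
    (hv : ((2 : ℕ) : 𝓞 ℚ) ∈ v.asIdeal) (p : ℕ) [Fact p.Prime] (hp : p = 2)
    (e : v.adicCompletion ℚ ≃+* ℚ_[p]) {q : v.adicCompletion ℚ} {k : ℕ} {u : ℤ_[p]}
    (hq : e q = (p : ℚ_[p]) ^ k * (u : ℚ_[p])) (hu : toZModPow 3 u = 3 ∨ toZModPow 3 u = 5)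
    (n : ℕ) {g : absoluteGaloisGroup (v.adicCompletion ℚ)} {ug : ℤ_[2]ˣ}
    (hug : ((κ (resGal (K := ℚ) (v.adicCompletion ℚ) g)).toAdd : ℤ_[2]) = 2 ^ n * (ug : ℤ_[2]))
    {R : ℕ} (hR : 1 ≤ R) {a : ℕ} (ha : Odd a) {f : AlgebraicClosure (v.adicCompletion ℚ)}
    (hf : ∀ h ∈ localSubgroup (κ.layerSubgroup (n + R)) (v.adicCompletion ℚ), h • f = f) :
    (∏ i ∈ Finset.range (2 ^ R), (g ^ i) • f) ≠
      algebraMap (v.adicCompletion ℚ) (AlgebraicClosure (v.adicCompletion ℚ)) (q ^ (2 ^ (R - 1) * a)) := by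
  intro hprod
  -- a local element `g₀` with `κ(res g₀) = 1`, and the representatives `g₀^j g^i` of `Γ/H_{n+R}`
  obtain ⟨g₀, hg₀'⟩ := surjective_kappa_comp_resGal hκ v hv (Multiplicative.ofAdd (1 : ℤ_[2]))
  have hg₀ : ((κ (resGal (K := ℚ) (v.adicCompletion ℚ) g₀)).toAdd : ℤ_[2]) = 2 ^ 0 * ((1 : ℤ_[2]ˣ) : ℤ_[2]) := by
    have h := congrArg Multiplicative.toAdd hg₀'
    rw [toAdd_ofAdd] at h
    rw [pow_zero, Units.val_one, one_mul]
    exact h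
  have hcov : ∀ σ : absoluteGaloisGroup (v.adicCompletion ℚ), ∃ ji : Fin (2 ^ n) × Fin (2 ^ R),
      σ⁻¹ * (g₀ ^ (ji.1 : ℕ) * g ^ (ji.2 : ℕ)) ∈ localSubgroup (κ.layerSubgroup (n + R)) (v.adicCompletion ℚ) := by
    intro σ
    have hσ0 : σ ∈ localSubgroup (κ.layerSubgroup 0) (v.adicCompletion ℚ) := by
      rw [mem_localSubgroup_iff, ZpExtension.mem_layerSubgroup, pow_zero]
      exact one_dvd _
    obtain ⟨j, hj, hjσ⟩ := exists_pow_inv_mul_mem_localSubgroup_layerSubgroup (κ := κ) v 0 n hg₀ hσ0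
    rw [Nat.zero_add] at hjσ
    obtain ⟨i, hi, hiσ⟩ := exists_pow_inv_mul_mem_localSubgroup_layerSubgroup (κ := κ) v n R hug hjσ
    refine ⟨(⟨j, hj⟩, ⟨i, hi⟩), ?_⟩
    have h := Subgroup.inv_mem _ hiσ
    have heq : ((g ^ i)⁻¹ * ((g₀ ^ j)⁻¹ * σ))⁻¹ = σ⁻¹ * (g₀ ^ j * g ^ i) := by group
    rw [heq] at h
    exact h
  -- the fixed field `F_{n+R}` and `f` as its element
  haveI := finiteDimensional_fixedField_localSubgroup_layerSubgroup (κ := κ) v (n + R)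
  haveI := isGalois_fixedField_localSubgroup_layerSubgroup (κ := κ) v (n + R)
  have hrank := finrank_fixedField_localSubgroup_layerSubgroup hκ v hv (n + R)
  have hopen := isOpen_localSubgroup (κ.layerSubgroup (n + R)) (κ.isOpen_layerSubgroup (n + R)) (v.adicCompletion ℚ)
  let f' : IntermediateField.fixedField (localSubgroup (κ.layerSubgroup (n + R)) (v.adicCompletion ℚ)) :=
    ⟨f, (IntermediateField.mem_fixedField_iff _ _).mpr fun h hh ↦ hf h hh⟩
  have hne := norm_ne_pow_of_tateUnit hκ v hv (m := n + R) (by omega) p hp e hq hu ha f'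
  have hcard : Fintype.card (Fin (2 ^ n) × Fin (2 ^ R)) = Module.finrank (v.adicCompletion ℚ)
      (IntermediateField.fixedField (localSubgroup (κ.layerSubgroup (n + R)) (v.adicCompletion ℚ))) := by
    rw [hrank, Fintype.card_prod, Fintype.card_fin, Fintype.card_fin, pow_add]
  -- (`CharZero ℚ_v` only now: it changes the preferred `Algebra ℚ ℚ_v` instance, see BRICK 14)
  haveI : CharZero (v.adicCompletion ℚ) :=
    charZero_of_injective_algebraMap (algebraMap ℚ (v.adicCompletion ℚ)).injective
  have hfix := fixingSubgroup_fixedField_of_isOpen _ hopen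
  have hH := fun σ ↦ SetLike.ext_iff.mp hfix σ
  have hnorm := algebraMap_norm_eq_prod_smul v _ hH (fun ji : Fin (2 ^ n) × Fin (2 ^ R) ↦ g₀ ^ (ji.1 : ℕ) * g ^ (ji.2 : ℕ))
    hcov hcard f'
  -- `∏_{j,i} g₀^j g^i f = ∏_j g₀^j (q^N) = q^{N 2^n}`
  have hinner : ∀ j : Fin (2 ^ n), (∏ i : Fin (2 ^ R), (g₀ ^ (j : ℕ) * g ^ (i : ℕ)) •
      (f' : AlgebraicClosure (v.adicCompletion ℚ))) =
        algebraMap (v.adicCompletion ℚ) (AlgebraicClosure (v.adicCompletion ℚ)) (q ^ (2 ^ (R - 1) * a)) := by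
    intro j
    have h1 : (∏ i : Fin (2 ^ R), (g₀ ^ (j : ℕ) * g ^ (i : ℕ)) • (f' : AlgebraicClosure (v.adicCompletion ℚ))) =
        g₀ ^ (j : ℕ) • ∏ i ∈ Finset.range (2 ^ R), (g ^ i) • f := by
      rw [← Fin.prod_univ_eq_prod_range (fun i ↦ (g ^ i) • f) (2 ^ R), Finset.smul_prod']
      refine Finset.prod_congr rfl fun i _ ↦ ?_
      rw [mul_smul]
    rw [h1, hprod]
    exact AlgEquiv.commutes (absoluteGaloisGroup.toAlgEquiv _ (g₀ ^ (j : ℕ))) _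
  rw [Fintype.prod_prod_type, Finset.prod_congr rfl (fun j _ ↦ hinner j), Finset.prod_const, Finset.card_univ,
    Fintype.card_fin, ← map_pow, ← pow_mul] at hnorm
  have hNe : Algebra.norm (v.adicCompletion ℚ) f' = q ^ (2 ^ (R - 1) * a * 2 ^ n) :=
    (algebraMap (v.adicCompletion ℚ) (AlgebraicClosure (v.adicCompletion ℚ))).injective hnorm
  have hexp : 2 ^ (R - 1) * a * 2 ^ n = 2 ^ (n + R - 1) * a := by
    rw [show n + R - 1 = n + (R - 1) by omega, pow_add]; ring
  rw [hexp] at hNe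
  exact hne hNe

end Literature.NumberTheory.EllipticCurves.Greenberg1999.MultTowerNS2

end Part7

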